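import Mathlib
import HarnessLib
import HarnessLib.Audit
import Literature.Probability.LatticeModels.RandomClusterFKG
import Literature.Probability.LatticeModels.TwoPointSupNormMonotone
import Literature.Probability.LatticeModels.IsingPlusEdwardsSokal
import Literature.Probability.LatticeModels.GKSInequalities
import Literature.Probability.LatticeModels.SharpnessProofs
import Literature.Probability.LatticeModels.MessagerMiracleSole
import Literature.Probability.LatticeModels.CriticalFKIsingBoxCrossingLower
import Literature.Probability.LatticeModels.ThermodynamicLimit
import Summits.CriticalPhenomena.Ising3DConformalLimit.Theses.ArmDressing
import Summits.CriticalPhenomena.Ising3DConformalLimit.Theses.ArmHyperscaling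
import Summits.CriticalPhenomena.Ising3DConformalLimit.Theses.MirrorHoelderCompactness
import Summits.CriticalPhenomena.Ising3DConformalLimit.Theorems.ArmDressingEvenPatternDecouplingPatternTransferDet
import Summits.CriticalPhenomena.Ising3DConformalLimit.Theorems.ArmDressingEvenPatternDecouplingArmBoxLimits
import Summits.CriticalPhenomena.Ising3DConformalLimit.Theorems.ArmDressingEvenPatternDecouplingPatternBoxLimits
import Summits.CriticalPhenomena.Ising3DConformalLimit.Theorems.ArmDressingEvenPatternDecouplingBallReadingTransferDet
import Summits.CriticalPhenomena.Ising3DConformalLimit.Theorems.ArmDressingEvenPatternDecouplingReadingPatternBoxLimit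
import Summits.CriticalPhenomena.Ising3DConformalLimit.Theorems.ArmDressingEvenPatternDecouplingMacroCrossingOfHyperscaling
import Summits.CriticalPhenomena.Ising3DConformalLimit.Theorems.ArmDressingEvenPatternDecouplingEvenPatternLowerGKS
import Summits.CriticalPhenomena.Ising3DConformalLimit.Theorems.ArmDressingEvenPatternDecouplingArmsUpperWired
import Summits.CriticalPhenomena.Ising3DConformalLimit.Theorems.ArmDressingEvenPatternDecouplingHybridRatioChain
import Summits.CriticalPhenomena.Ising3DConformalLimit.Theorems.ArmDressingEvenPatternDecouplingKestenArmMixingGlue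
import Summits.CriticalPhenomena.Ising3DConformalLimit.Theorems.ArmDressingEvenPatternDecouplingUniqueOfBallAndMixing
import Summits.CriticalPhenomena.Ising3DConformalLimit.Theorems.ArmDressingEvenPatternDecouplingHyperscalingOfItems
import Summits.CriticalPhenomena.Ising3DConformalLimit.Theorems.ArmDressingEvenPatternDecouplingNondegenerateOfHS
import Summits.CriticalPhenomena.Ising3DConformalLimit.Theorems.ArmDressingEvenPatternDecouplingAssemblyBirth
import Summits.CriticalPhenomena.Ising3DConformalLimit.Theorems.ArmDressingEvenPatternDecouplingAssemblyReading
import Summits.CriticalPhenomena.Ising3DConformalLimit.Theorems.ArmDressingEvenPatternDecouplingBallLawsRatio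
import Summits.CriticalPhenomena.Ising3DConformalLimit.Theorems.ArmDressingEvenPatternDecouplingRestrictedGraphs

/-!
# Crux `ArmDressing.EvenPatternDecoupling` (stmt-CriticalPhenomena-16133) — line `registered` (birth skeleton),
# revision 12 (continuation lead `prover-line-stmt-CriticalPhenomena-16133-c2-0`, 2026-08-17, cycle 3)

Route `route-CriticalPhenomena-ArmDressing` (crux rank 4, "the 3D substitute for RSW circuits, PATTERN half":
CamiaFeng2025 Lemmas 12 and 14 transposed to `ℤ³`), sub-problem `Ising3DConformalLimit`. The crux is FIXED (its
decl and signature are the route's, `Theses/ArmDressing.lean`); `EvenPatternDecoupling_of` below concludes it BY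
NAME from the registered stubs, with NO sorry outside the `stub_*` theorems.

## The crux, read as analysis

With `U := {z | ∀ j, z_j ∈ B(c_j, r_j)}`, `F(δ, z) := Pr[EVEN(z^δ)] / Pr[∀ j, z_j^δ ↔ (D_j^c)^δ]` (point-conditioned
even pattern) and `G(δ; b, s) := Pr[EVEN2 ∩ CROSS] / Pr[CROSS]` for the family (closed inner balls) ++ (outer
complements) (ball-conditioned pattern), the crux asks for `q` continuous and positive on `U` with (i) `F(δ,·) → q`
locally uniformly along `δ → 0⁺` and (ii) along every inner family shrinking to `z`, `lim_δ G` exists eventually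
and tends to `q z`. All `Pr` are `limUnder atTop` of wired critical FK-Ising box probabilities on `Λ_L ⊂ ℤ³`.

## Revision 4 (this cycle): the heart in CANONICAL form — reading scale `t` separated from conditioning scale `s`

Revision 3 (cycle 1) read the crossing clusters, their uniqueness `Uni` and their parity pattern `Patt` at the SAME
inner family `(b, s)` that carries the ball-arm conditioning, so its mixing stub compared point- and ball-conditioned
laws of an event adjacent to the rim of the conditioning balls (no buffer: the refuter probe "near-rim sensitivity").
Revision 4 reads `Uni`/`Patt` at a READING family `(z₀, t)` chosen from `(z₀, ε)` alone, and conditions on arms from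
points / balls deep inside `B(z₀_j, t_j/2)` with radii `s_j < η₀ ≪ t_j`:

* `stub_kestenArmMixing` [M'] (OPEN, THE HEART, now canonical): **Kesten's one-arm decoupling / uniqueness of the
  one-arm IIC in ratio form with a buffer** — for every reading family `(z₀, t)` and `ε > 0` there are `V ∋ z₀`,
  `η₀ > 0` such that for every inner family `(b, s)` with `s_j < η₀`, `B̄(b_j,s_j) ⊆ B(z₀_j, t_j/2)`, eventually as
  `δ → 0⁺`, for all `z ∈ V` well inside and EVERY family of events `E_L` measurable with respect to the edges with
  both ends outside the reading balls, eventually in `L`: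
  `|μ_L(E_L | point arms from z^δ) - μ_L(E_L | ball arms from B̄(b,s)^δ)| ≤ ε` (total-variation closeness of the
  two arm-conditioned laws outside `B(z₀, t)`; Panis2025 Open Problem 1 in ratio form; the planar mechanism is
  Kesten 1986 / Camia–Feng Lemma 12 via RSW circuits in `B(z₀,t) ∖ B(b,s)`). Reusable verbatim by crux C's line.
* `stub_readingCrossingUnique` [U'] (OPEN): **uniqueness of the annulus-crossing cluster at the reading scale, given
  the arms** — for `ε > 0` there is `t₀ > 0` such that for reading radii `t_j < t₀`, conditionally on the point arms
  (resp. the `s`-ball arms) from deep inside `B(z₀_j, t_j/2)`, all rim sites of `B̄(z₀_j, t_j)` joined outside the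
  reading balls to `B(c_j,r_j)ᶜ` are joined to each other outside the reading balls, up to probability `ε ×` arms.
* [LANDED p155842, wave 3] `stub_ballReadingTransferDet` [D2]: the deterministic transfer for `s`-balls inside reading
  balls — on box-supported configurations with the ball arms and `Uni(z₀,t)`, `EVEN2 ∩ CROSS ↔ Patt(z₀,t)`
  (`Literature.Probability.Percolation.WalkExcursionDecomposition`, as the landed `stub_patternTransferDet`, p150394,
  which is the point-to-reading transfer used for the point side).
* [LANDED p156155, wave 3] `stub_readingPatternBoxLimit` [L']: the wired-box probabilities of
  `Uni(z₀,t) ∩ Patt(z₀,t) ∩ {s-ball arms}` converge as `L → ∞` (the landed `stub_patternBoxLimits`, p151733, proves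
  this for equal reading and conditioning families; same proof, `CriticalFKIsingThinnedConnectionLaws`).
* glue PROVED here: `uniPatt_far` (`Uni ∩ Patt` at the reading family is measurable outside the reading balls),
  `pieces_assembly2` (abstract: det transfers + uniqueness + TV mixing + limits ⇒ locally uniform point-to-ball
  decoupling; the reading radius is chosen as `min(t₀, admissibility slack)/2`, the neighbourhood is shrunk into
  `∏ B(z₀_j, t/4)` and `η₀ ≤ t/6`, so that every inner family that can contain a point of `V` well inside lies in
  `B(z₀_j, t_j/2)` — other families are served vacuously), `pointToBallDecoupling_of_pieces`.

## Revision 6 (this cycle, after wave 3): [N] and [G] both reduce to ONE canonical open input [HS]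

The cycle-2 status workers found that the RSW-type stub [N] (`stub_macroCrossingNondegenerate`) and the gluing
stub [G] (`stub_gluingAllConnected`) of revisions 3–5 reduce to the SAME two-point/one-arm input, one-arm
hyperscaling at every ratio:

* `stub_armHyperscalingAllRatios` [HS] (OPEN, pure tree vocabulary): `∀ lam ≥ 1, ∃ κ > 0, ∃ N₀, ∀ N ≥ N₀,
  κ · (thetaWiredBox 3 p_c 2 N)² ≤ criticalTwoPoint 3 (lam N e₀)` — item stmt-CriticalPhenomena-15591
  `ArmHyperscaling.OneArmHyperscaling` is the instance "arm scale `K n`, distance `2n`"; [HS] = 15591 at `K = 1`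
  + two-point doubling (`MirrorHoelderCompactness.TwoPointDoubling`, open item); Tasaki's converse is provable.
* [LANDED p160110, wave 4; + Literature p158703 RandomClusterTwoBoxArmBound, p159531 CriticalFKIsingBoxCrossingLower] `stub_macroCrossingOfHyperscaling` [NofHS]: [HS] ⇒ [N] (domain Markov with wired maximal,
  two small boxes, FKG for `n` annuli, MMS, limits by `stub_armBoxLimits`); glue `macroCrossing_of_HS`.
* [LANDED p157913, wave 4] `stub_evenPatternLowerGKS` [GKS]: `Pr[EVEN(z^δ)] ≥ ∏_{pairs} criticalTwoPoint` (ES with +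
  boundary in the wired limit + Griffiths II), eventually in `δ`, for `2k` injective points.
* [LANDED p158571, wave 4] `stub_armsUpperWired` [ARM]: `0 < Pr[all point arms] ≤ θ¹_{⌊a/δ⌋₊}^n` when `B̄(z_j,4a)` lie
  in the disjoint outer balls (domain Markov, wired maximal, disjoint boxes; positivity from `stub_armBoxLimits`).
* glue PROVED here: `evenPatternNondegenerate_of_HS` ([HS] + [GKS] + [ARM] ⇒ birth stub 3 for every even `n`:
  pairs `(castAdd i, natAdd i)`, common slack `a`, `N = ⌊a/δ⌋₊`, ratio `lam = ⌈6D/a⌉₊ + 7`, MMS step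
  `criticalTwoPoint_single_le`, arithmetic `three_mul_ceil_le`, `supNorm_latticeApprox_sub_le`,
  `pow_le_div_of_bounds`), so the ALL-connected gluing stub [G] is gone (the line only ever consumed the EVEN form).

Unchanged: `stub_ballLawsExist` [A] (= crux A 16131 existence clause; `ballLawsExist_of_ballConnectivityMoebius`),
the birth assembly `decoupling_assembly`, `ballPatternLimit_of`, and the landed `stub_patternTransferDet` (p150394),
`stub_armBoxLimits` (p149935), `stub_patternBoxLimits` (p151733), `stub_ballReadingTransferDet` (p155842),
`stub_readingPatternBoxLimit` (p156155).

## Revision 9: [HS] itself is DERIVED from two EXISTING items (kernel-checked cross-route link)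

`armHyperscalingAllRatios_of_items`: `ArmHyperscaling.OneArmHyperscaling` (item 15591, any ratio constant `K`) ∧
`MirrorHoelderCompactness.TwoPointDoubling` (item 6150) ⇒ [HS] (for `N ≥ 2K+2`, `n := (N-1)/K`: the wired arm of `Λ_N` is
the `+` magnetisation of `Λ_{N-1}`, `≤` that of `Λ_{Kn}` by Griffiths antitonicity in the volume; 15591 bounds its square by
`C·G(2n e₀)`; doubling iterated `j := lam·K` times and MMS axis antitonicity bring `G(2n e₀)` up to `G(lam N e₀)`).
The registered stubs for the hyperscaling input are now the two item statements VERBATIM (`stub_oneArmHyperscaling`,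
`stub_twoPointDoubling`), exactly as `stub_ballLawsExist` is crux A's existence clause verbatim.

Registered stubs (5, revision 9): [A] `stub_ballLawsExist` (= item 16131, existence clause), [OA] `stub_oneArmHyperscaling`
(= item 15591 verbatim), [TD] `stub_twoPointDoubling` (= item 6150 verbatim), [U'] `stub_readingCrossingUnique`,
[M'] `stub_kestenArmMixing` (the heart). Kernel-checked:
    crux B (EvenPatternDecoupling, 16133)  ⇐  16131(existence) ∧ 15591 ∧ 6150 ∧ CrossingClusterUnique (U') ∧ OneArmIIC (M').
Only U' and M' are statements not already filed as items; they are the planner's foreseen layer-2 children of cruxes B and C.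

## Revision 10 (cycle 3, lead c2): the two open estimates in CANONICAL, promotable form

* [K] `stub_oneArmRatioMixing` (OPEN, THE HEART, now a single-ball LATTICE statement with no continuum data):
  **Kesten's one-arm RATIO MIXING uniform in the far data** — for the wired critical FK-Ising measure on `Λ_L`, seeds
  `x ∈ S ⊆ B_m(x)`, a blind ball `B_M(x)`, `M ≥ λ(ε) m`, `m ≥ m₀(ε)`, `B_{M+1}(x) ⊆ Λ_L`, targets `T, T'` off `B_M(x)`
  and events `F, F'` determined off `B_M(x)`:  `μ(F ∩ {x↔T}) μ(F' ∩ {S↔T'}) ≤ (1+ε) μ(F' ∩ {x↔T'}) μ(F ∩ {S↔T})`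
  (the conditional probability `μ(x ↔ T | S ↔ T, F)` does not depend on the far data). It implies [M'] for every `n`:
  [LANDED p164679, wave 1] `stub_hybridRatioChain` (the hybrid argument over the balls, pure measure algebra) and
  [LANDED p165048, lead] `stub_kestenArmMixingGlue` ([K] ⇒ [M']: radii bookkeeping, far-measurability of the other
  balls' arm events by first-exit walk surgery `armEvent_iff_of_agree`, uniform separation of the outer balls,
  positivity of the joint point-arm event); here `kestenArmMixing_of_ratioMixing`.
* [U_b] `stub_ballCrossingUnique` (OPEN): the BALL-conditioned clause of U' only; the point-conditioned clause follows
  from it and [M'] because `Uniᶜ` is a far event (`uni_far`, proved): [LANDED p165729, wave 2]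
  `stub_uniqueOfBallAndMixing` (abstract bookkeeping) and `readingCrossingUnique_of` (proved).

## Revision 11 (cycle 3, lead c2): the uniqueness input in CANONICAL LATTICE form too

* [U1] `stub_annulusCrossingUnique` (OPEN): uniqueness of the crossing cluster of ONE annulus `EB(p,R) ∖ EB(p,ρ)` of Euclidean
  lattice balls, given a seed arm, uniform in the far data (events determined off `EB(p,R)`), `R ≥ λ(ε)ρ`, `ρ ≥ ρ₀(ε)` — the
  uniqueness input (ii) of Basu–Sapozhnikov 2017 (Kesten's IIC in `d ≥ 3`) in seed-arm form. It implies [U_b] for every `n`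
  (`ballCrossingUnique_of_annulus`, PROVED here: union bound over the balls, `NonUni_k ⊆ LNU` by graph monotonicity, the other
  balls' arms are far by `armEvent_iff_of_agree`).

## Revision 12 (cycle 3, lead c2): the proved generic layers LANDED as supports files

`armHyperscalingAllRatios_of_items` (p167550, …HyperscalingOfItems), `evenPatternNondegenerate_of_HS` (p167551,
…NondegenerateOfHS), `admissible_of_fine` + `decoupling_assembly` (p167631, …AssemblyBirth), `abs_div_sub_div_le` +
`measureReal_transfer` + `pieces_assembly2` (p167761, …AssemblyReading), `exists_tendsto_div_of_ballLaws` (p168000,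
…BallLawsRatio) are imported from the tree; the skeleton keeps only the
stubs, the internal targets, the far-measurability lemmas and the glue.

Registered stubs (5, revisions 11–12): [A] `stub_ballLawsExist` (= item 16131, existence clause), [OA] `stub_oneArmHyperscaling`
(= item 15591 verbatim), [TD] `stub_twoPointDoubling` (= item 6150 verbatim), [U1] `stub_annulusCrossingUnique`,
[K] `stub_oneArmRatioMixing` (the heart) — the last two are single-ball LATTICE statements, uniform in the far data. Kernel-checked:
    crux B (16133)  ⇐  16131(existence) ∧ 15591 ∧ 6150 ∧ AnnulusCrossingUnique (U1) ∧ OneArmRatioMixing (K).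
Disproof used: none exists for this crux (`ledger crux ls`). Dead lines: none.
-/

set_option maxHeartbeats 1000000

namespace Summit.CriticalPhenomena.Ising3DConformalLimit.Cruxes.EvenPatternDecoupling.Birth

open scoped Topology
open Filter Set Metric

/-- stub A (OPEN — verbatim the EXISTENCE clause of crux A `BallConnectivityMoebius`, item stmt-CriticalPhenomena-16131;
see `ballLawsExist_of_ballConnectivityMoebius`): **scaling limits of the connection laws of generalised-ball families of
critical FK-Ising on `ℤ³` exist** — for every `m`, every relation set `R` and every datum `p` of `m` generalised balls
(`(x, ρ)`: the closed ball of radius `ρ > 0`, or the closed exterior of the open ball of radius `-ρ > 0`), the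
infinite-volume probability that the connection relation of the discretised family at mesh `δ` lies in `R` converges
as `δ → 0⁺` (the existence half of the 3D Cardy–Smirnov statement; no continuity, no invariance). -/
theorem stub_ballLawsExist : open Literature.Probability.LatticeModels Literature.Probability.Percolation Literature.Barriers.CriticalPhenomena Filter Topology in let E3 := EuclideanSpace ℝ (Fin 3); let μ : (L : ℕ) → MeasureTheory.Measure (BondConfig (BoxV 3 L)) := fun L => rcMeasure (boxGraph 3 L) (fkIsingParam (criticalBeta 3)) 2 (boxBoundary 3 L); let PrL : (m : ℕ) → (Fin m → Set (Site 3)) → Set (Fin m → Fin m → Prop) → ℕ → ℝ := fun _ K R L => (μ L).real {ω | (fun i j => ∃ x y : BoxV 3 L, x.1 ∈ K i ∧ y.1 ∈ K j ∧ (openGraph ω).Reachable x y) ∈ R}; let Pr : (m : ℕ) → (Fin m → Set (Site 3)) → Set (Fin m → Fin m → Prop) → ℝ := fun m K R => limUnder atTop (PrL m K R); let mesh : ℝ → Site 3 → E3 := fun δ z => WithLp.toLp 2 fun i : Fin 3 => δ * (z i : ℝ); let disc : ℝ → Set E3 → Set (Site 3) := fun δ A => {x | mesh δ x ∈ A}; let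 EVEN : (n : ℕ) → Set (Fin n → Fin n → Prop) := fun n => {R | ∀ i, Even ({j : Fin n | R i j}.ncard)}; let EVEN2 : (n : ℕ) → Set (Fin (n + n) → Fin (n + n) → Prop) := fun n => {R | ∀ i : Fin n, Even ({j : Fin n | R (Fin.castAdd n i) (Fin.castAdd n j)}.ncard)}; let CROSS : (n : ℕ) → Set (Fin (n + n) → Fin (n + n) → Prop) := fun n => {R | ∀ i : Fin n, R (Fin.castAdd n i) (Fin.natAdd n i)}; let pts : (n : ℕ) → ℝ → (Fin n → E3) → (Fin n → Set (Site 3)) := fun _ δ z j => {latticeApprox δ (z j)}; let fam : (n : ℕ) → ℝ → (Fin n → Set E3) → (Fin n → Set E3) → (Fin (n + n) → Set (Site 3)) := fun _ δ A B => Fin.append (fun j => disc δ (A j)) (fun j => disc δ (B j)); ∀ (m : ℕ) (R : Set (Fin m → Fin m → Prop)), ∃ lam : (Fin m → E3 × ℝ) → ℝ, ∀ p : Fin m → E3 × ℝ, (∀ i, (p i).2 ≠ 0) → Tendsto (fun δ => Pr m (fun i => disc δ (if 0 < (p i).2 then Metric.closedBall (p i).1 (p i).2 else (Metric.ball (p i).1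 (-(p i).2))ᶜ)) R) (𝓝[>] 0) (𝓝 (lam p)) := by
  sorry

/-- stub OA (OPEN — VERBATIM the statement of item stmt-CriticalPhenomena-15591 `ArmHyperscaling.OneArmHyperscaling`, crux of
route ArmHyperscaling): one-arm hyperscaling on `ℤ³`, `∃ K ≥ 1, ∃ C, ∀ n ≥ 1, (⟨σ₀⟩⁺_{Λ_{Kn};β_c})² ≤ C·⟨σ₀σ_{2ne₀}⟩⁺_{β_c}`
(Tasaki's inequality saturated). With [TD] it gives [HS] (`armHyperscalingAllRatios_of_items`), hence [N] and the birth
non-degeneracy. Lands the moment item 15591 is proved (the stub is its decl by name). -/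
theorem stub_oneArmHyperscaling : Summit.CriticalPhenomena.Ising3DConformalLimit.Theses.ArmHyperscaling.OneArmHyperscaling := by
  sorry

/-- stub TD (OPEN — VERBATIM the statement of item stmt-CriticalPhenomena-6150 `MirrorHoelderCompactness.TwoPointDoubling`, crux of
route MirrorHoelderCompactness): all-scale doubling of the axial critical two-point function on `ℤ³`,
`∃ κ > 0, ∀ n ≥ 1, κ·⟨σ₀σ_{ne₀}⟩⁺_{β_c} ≤ ⟨σ₀σ_{2ne₀}⟩⁺_{β_c}`. Lands the moment item 6150 is proved. -/
theorem stub_twoPointDoubling : Summit.CriticalPhenomena.Ising3DConformalLimit.Theses.MirrorHoelderCompactness.TwoPointDoubling := by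
  sorry

/-- stub U1 (OPEN in `d = 3` — "CrossingClusterUnique" in CANONICAL LATTICE FORM, revision 11; the uniqueness input (ii) of
Basu–Sapozhnikov 2017 for Kesten's IIC, seed-arm form, uniform in the far data): **the crossing cluster of an annulus
from a mesoscopic Euclidean lattice ball is unique, given a seed arm, uniformly in everything outside.** For the wired
critical FK-Ising measure `μ_L` on `Λ_L ⊂ ℤ³`: ∀ ε ∃ λ ≥ 1, ρ₀ > 0 such that for radii `ρ ≥ ρ₀`, `R ≥ λρ`, a centre
`p ∈ ℝ³`, the Euclidean lattice balls `Q = EB(p, ρ) ⊆ W = EB(p, R)` (`EB(p, R+2) ⊆ Λ_L`), seeds `S ⊆ EB(p, ρ/2)`, targets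
`T` off `W` and events `F` determined (on box-supported configurations) by the edges with both ends off `W`:
`μ(F ∩ {S ↔ T} ∩ LNU(Q, W)) ≤ ε · μ(F ∩ {S ↔ T})`, where `LNU(Q, W)` ("local non-uniqueness") says: two rim sites of `Q`
(outside `Q`, lattice-adjacent to `Q`) are each joined OUTSIDE `Q` by open edges to a site off `W`, but are not joined to
each other by open edges with both ends in `W ∖ Q`. A second crossing cluster of the annulus `W ∖ Q` costs a further arm
from scale `ρ` to scale `R` (no RSW circuits, no BK for `q = 2` in `d = 3`); planar: RSW (Duminil-Copin–Hongler–Nolin 2011)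
merges all crossings by an open circuit. Implies [U_b] for every `n` (union bound over the balls, `ballCrossingUnique_of_annulus`). -/
theorem stub_annulusCrossingUnique : open Literature.Probability.LatticeModels Literature.Probability.Percolation Literature.Barriers.CriticalPhenomena in let E3 := EuclideanSpace ℝ (Fin 3); let μ : (L : ℕ) → MeasureTheory.Measure (BondConfig (BoxV 3 L)) := fun L => rcMeasure (boxGraph 3 L) (fkIsingParam (criticalBeta 3)) 2 (boxBoundary 3 L); let emb : Site 3 → E3 := fun y => WithLp.toLp 2 fun i : Fin 3 => (y i : ℝ); let EB : E3 → ℝ → Set (Site 3) := fun p ρ => {y | dist (emb y) p ≤ ρ}; let Conn : (L : ℕ) → Set (Site 3) → Set (Site 3) → Set (BondConfig (BoxV 3 L)) := fun L S T => {ω | ∃ a b : BoxV 3 L, a.1 ∈ S ∧ b.1 ∈ T ∧ (openGraph ω).Reachable a b}; let FarEv : (L : ℕ) → Set (Site 3) → Set (BondConfig (BoxV 3 L)) → Prop := fun L Q F => ∀ ω ω' : BondConfig (BoxV 3 L), ω ⊆ (boxGraph 3 L).edgeSet → ω' ⊆ (boxGraph 3 L).edgeSet → (∀ u v : BoxV 3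 L, u.1 ∉ Q → v.1 ∉ Q → (s(u, v) ∈ ω ↔ s(u, v) ∈ ω')) → (ω ∈ F ↔ ω' ∈ F); let ROq : (L : ℕ) → BondConfig (BoxV 3 L) → Set (Site 3) → BoxV 3 L → BoxV 3 L → Prop := fun L ω P a b => (SimpleGraph.fromRel fun a a' : BoxV 3 L => s(a, a') ∈ ω ∧ a.1 ∈ P ∧ a'.1 ∈ P).Reachable a b; let LNU : (L : ℕ) → Set (Site 3) → Set (Site 3) → Set (BondConfig (BoxV 3 L)) := fun L Q W => {ω | ∃ u u' : BoxV 3 L, u.1 ∉ Q ∧ u'.1 ∉ Q ∧ (∃ v : BoxV 3 L, v.1 ∈ Q ∧ (boxGraph 3 L).Adj u v) ∧ (∃ v' : BoxV 3 L, v'.1 ∈ Q ∧ (boxGraph 3 L).Adj u' v') ∧ (∃ w : BoxV 3 L, w.1 ∉ W ∧ ROq L ω Qᶜ u w) ∧ (∃ w' : BoxV 3 L, w'.1 ∉ W ∧ ROq L ω Qᶜ u' w') ∧ ¬ ROq L ω (Qᶜ ∩ W) u u'}; ∀ ε : ℝ, 0 < ε → ∃ lam ρ₀ : ℝ, 1 ≤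 lam ∧ 0 < ρ₀ ∧ ∀ (ρ R : ℝ), ρ₀ ≤ ρ → lam * ρ ≤ R → ∀ (L : ℕ) (p : E3) (S T : Set (Site 3)), S ⊆ EB p (ρ / 2) → EB p (R + 2) ⊆ (box 3 L : Set (Site 3)) → Disjoint T (EB p R) → ∀ F : Set (BondConfig (BoxV 3 L)), FarEv L (EB p R) F → (μ L).real (F ∩ Conn L S T ∩ LNU L (EB p ρ) (EB p R)) ≤ ε * (μ L).real (F ∩ Conn L S T) := by
  sorry


/-- stub K (OPEN in `d = 3`, THE HEART in CANONICAL LATTICE FORM, revision 10 — **Kesten's one-arm RATIO MIXING,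
uniform in the far data**; one ball, no continuum, no mesh; planar mechanism: Kesten 1986 §2 / Garban–Pete–Schramm
2013 coupling / Camia–Feng 2025 Lemma 12; `d = 3`: Panis 2025 Open Problem 1 (uniqueness of the one-arm IIC)).
For the wired critical FK-Ising measure `μ_L` on `Λ_L ⊂ ℤ³`, a lattice site `x`, a seed set `S` with
`x ∈ S ⊆ B_m(x)` (sup-norm lattice ball), a blind ball `B_M(x)` with `M ≥ λ(ε)·m`, `m ≥ m₀(ε)`, `B_{M+1}(x) ⊆ Λ_L`,
target sets `T, T'` off `B_M(x)` and events `F, F'` determined (on box-supported configurations) by the edges with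
both ends off `B_M(x)`:  `μ(F ∩ {x ↔ T}) · μ(F' ∩ {S ↔ T'}) ≤ (1+ε) · μ(F' ∩ {x ↔ T'}) · μ(F ∩ {S ↔ T})`,
i.e. the ratio `μ(F ∩ {x ↔ T}) / μ(F ∩ {S ↔ T}) = μ(x ↔ T | S ↔ T, F)` does not depend on the far data `(F, T)`
up to `1 ± ε`: **conditionally on an arm from the seed, whether the point itself is on the arm is decided near the
seed — the far field forgets how the arm starts.** Implies [M'] for every `n` by a hybrid argument over the balls
(`stub_kestenArmMixingGlue`, LANDED p165048); reusable verbatim by crux C (16132, `stub_kestenForgetting`). -/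
theorem stub_oneArmRatioMixing : open Literature.Probability.LatticeModels Literature.Probability.Percolation Literature.Barriers.CriticalPhenomena in let μ : (L : ℕ) → MeasureTheory.Measure (BondConfig (BoxV 3 L)) := fun L => rcMeasure (boxGraph 3 L) (fkIsingParam (criticalBeta 3)) 2 (boxBoundary 3 L); let Conn : (L : ℕ) → Set (Site 3) → Set (Site 3) → Set (BondConfig (BoxV 3 L)) := fun L S T => {ω | ∃ a b : BoxV 3 L, a.1 ∈ S ∧ b.1 ∈ T ∧ (openGraph ω).Reachable a b}; let Bx : Site 3 → ℕ → Set (Site 3) := fun x m => {y | ∀ i, |y i - x i| ≤ m}; let FarEv : (L : ℕ) → Set (Site 3) → Set (BondConfig (BoxV 3 L)) → Prop := fun L Q F => ∀ ω ω' : BondConfig (BoxV 3 L), ω ⊆ (boxGraph 3 L).edgeSet → ω' ⊆ (boxGraph 3 L).edgeSet → (∀ u v : BoxV 3 L, u.1 ∉ Q → v.1 ∉ Q → (s(u, v) ∈ ω ↔ s(u, v) ∈ ω')) → (ω ∈ F ↔ ω' ∈ F); ∀ ε : ℝ, 0 < ε → ∃ lam m₀ : ℕ, ∀ m : ℕ,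 m₀ ≤ m → ∀ M : ℕ, lam * m ≤ M → ∀ (L : ℕ) (x : Site 3) (S T T' : Set (Site 3)), x ∈ S → S ⊆ Bx x m → Bx x (M + 1) ⊆ (box 3 L : Set (Site 3)) → Disjoint T (Bx x M) → Disjoint T' (Bx x M) → ∀ F F' : Set (BondConfig (BoxV 3 L)), FarEv L (Bx x M) F → FarEv L (Bx x M) F' → (μ L).real (F ∩ Conn L {x} T) * (μ L).real (F' ∩ Conn L S T') ≤ (1 + ε) * ((μ L).real (F' ∩ Conn L {x} T') * (μ L).real (F ∩ Conn L S T)) := by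
  sorry



/-! ### Name-keyed aliases of the stub statements (verbatim the types of the `stub_*` theorems above;
the skeleton audit admits hypotheses of `EvenPatternDecoupling_of` only BY NAME) -/

namespace Registered

set_option linter.unusedVariables false

/-- Registered stub `stub_ballLawsExist` as a proposition (verbatim its type). -/
abbrev stub_ballLawsExist : Prop := open Literature.Probability.LatticeModels Literature.Probability.Percolation Literature.Barriers.CriticalPhenomena Filter Topology in let E3 := EuclideanSpace ℝ (Fin 3); let μ : (L : ℕ) → MeasureTheory.Measure (BondConfig (BoxV 3 L)) := fun L => rcMeasure (boxGraph 3 L) (fkIsingParam (criticalBeta 3)) 2 (boxBoundary 3 L); let PrL : (m : ℕ) → (Fin m → Set (Site 3)) → Set (Fin m → Fin m → Prop) → ℕ → ℝ := fun _ K R L => (μ L).real {ω | (fun i j => ∃ x y : BoxV 3 L, x.1 ∈ K i ∧ y.1 ∈ K j ∧ (openGraph ω).Reachable x y) ∈ R}; let Pr : (m : ℕ) → (Fin m → Set (Site 3)) → Set (Fin m → Fin m → Prop) → ℝ := fun m K R => limUnder atTop (PrL m K R); let mesh : ℝ → Site 3 → E3 := fun δ z => WithLp.toLp 2 fun i : Fin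 3 => δ * (z i : ℝ); let disc : ℝ → Set E3 → Set (Site 3) := fun δ A => {x | mesh δ x ∈ A}; let EVEN : (n : ℕ) → Set (Fin n → Fin n → Prop) := fun n => {R | ∀ i, Even ({j : Fin n | R i j}.ncard)}; let EVEN2 : (n : ℕ) → Set (Fin (n + n) → Fin (n + n) → Prop) := fun n => {R | ∀ i : Fin n, Even ({j : Fin n | R (Fin.castAdd n i) (Fin.castAdd n j)}.ncard)}; let CROSS : (n : ℕ) → Set (Fin (n + n) → Fin (n + n) → Prop) := fun n => {R | ∀ i : Fin n, R (Fin.castAdd n i) (Fin.natAdd n i)}; let pts : (n : ℕ) → ℝ → (Fin n → E3) → (Fin n → Set (Site 3)) := fun _ δ z j => {latticeApprox δ (z j)}; let fam : (n : ℕ) → ℝ → (Fin n → Set E3) → (Fin n → Set E3) → (Fin (n + n) → Set (Site 3)) := fun _ δ A B => Fin.append (fun j => disc δ (A j)) (fun j => disc δ (B j)); ∀ (m : ℕ) (R : Set (Fin m → Fin m → Prop)), ∃ lam : (Fin m → E3 × ℝ) → ℝ, ∀ p : Fin m → E3 × ℝ, (∀ i, (p i).2 ≠ 0) → Tendsto (fun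 δ => Pr m (fun i => disc δ (if 0 < (p i).2 then Metric.closedBall (p i).1 (p i).2 else (Metric.ball (p i).1 (-(p i).2))ᶜ)) R) (𝓝[>] 0) (𝓝 (lam p))

/-- Registered stub `stub_oneArmHyperscaling` as a proposition (verbatim its type). -/
abbrev stub_oneArmHyperscaling : Prop := Summit.CriticalPhenomena.Ising3DConformalLimit.Theses.ArmHyperscaling.OneArmHyperscaling

/-- Registered stub `stub_twoPointDoubling` as a proposition (verbatim its type). -/
abbrev stub_twoPointDoubling : Prop := Summit.CriticalPhenomena.Ising3DConformalLimit.Theses.MirrorHoelderCompactness.TwoPointDoubling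

/-- Registered stub `stub_annulusCrossingUnique` as a proposition (verbatim its type). -/
abbrev stub_annulusCrossingUnique : Prop := open Literature.Probability.LatticeModels Literature.Probability.Percolation Literature.Barriers.CriticalPhenomena in let E3 := EuclideanSpace ℝ (Fin 3); let μ : (L : ℕ) → MeasureTheory.Measure (BondConfig (BoxV 3 L)) := fun L => rcMeasure (boxGraph 3 L) (fkIsingParam (criticalBeta 3)) 2 (boxBoundary 3 L); let emb : Site 3 → E3 := fun y => WithLp.toLp 2 fun i : Fin 3 => (y i : ℝ); let EB : E3 → ℝ → Set (Site 3) := fun p ρ => {y | dist (emb y) p ≤ ρ}; let Conn : (L : ℕ) → Set (Site 3) → Set (Site 3) → Set (BondConfig (BoxV 3 L)) := fun L S T => {ω | ∃ a b : BoxV 3 L, a.1 ∈ S ∧ b.1 ∈ T ∧ (openGraph ω).Reachable a b}; let FarEv : (L : ℕ) → Set (Site 3) → Set (BondConfig (BoxV 3 L)) → Prop := fun L Q F => ∀ ω ω' : BondConfig (BoxV 3 L), ω ⊆ (boxGraph 3 L).edgeSet → ω' ⊆ (boxGraph 3 L).edgeSet → (∀ u v : BoxV 3 L, u.1 ∉ Q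 → v.1 ∉ Q → (s(u, v) ∈ ω ↔ s(u, v) ∈ ω')) → (ω ∈ F ↔ ω' ∈ F); let ROq : (L : ℕ) → BondConfig (BoxV 3 L) → Set (Site 3) → BoxV 3 L → BoxV 3 L → Prop := fun L ω P a b => (SimpleGraph.fromRel fun a a' : BoxV 3 L => s(a, a') ∈ ω ∧ a.1 ∈ P ∧ a'.1 ∈ P).Reachable a b; let LNU : (L : ℕ) → Set (Site 3) → Set (Site 3) → Set (BondConfig (BoxV 3 L)) := fun L Q W => {ω | ∃ u u' : BoxV 3 L, u.1 ∉ Q ∧ u'.1 ∉ Q ∧ (∃ v : BoxV 3 L, v.1 ∈ Q ∧ (boxGraph 3 L).Adj u v) ∧ (∃ v' : BoxV 3 L, v'.1 ∈ Q ∧ (boxGraph 3 L).Adj u' v') ∧ (∃ w : BoxV 3 L, w.1 ∉ W ∧ ROq L ω Qᶜ u w) ∧ (∃ w' : BoxV 3 L, w'.1 ∉ W ∧ ROq L ω Qᶜ u' w') ∧ ¬ ROq L ω (Qᶜ ∩ W) u u'}; ∀ ε : ℝ, 0 < ε → ∃ lam ρ₀ : ℝ, 1 ≤ lam ∧ 0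 < ρ₀ ∧ ∀ (ρ R : ℝ), ρ₀ ≤ ρ → lam * ρ ≤ R → ∀ (L : ℕ) (p : E3) (S T : Set (Site 3)), S ⊆ EB p (ρ / 2) → EB p (R + 2) ⊆ (box 3 L : Set (Site 3)) → Disjoint T (EB p R) → ∀ F : Set (BondConfig (BoxV 3 L)), FarEv L (EB p R) F → (μ L).real (F ∩ Conn L S T ∩ LNU L (EB p ρ) (EB p R)) ≤ ε * (μ L).real (F ∩ Conn L S T)


/-- Registered stub `stub_oneArmRatioMixing` as a proposition (verbatim its type). -/
abbrev stub_oneArmRatioMixing : Prop := open Literature.Probability.LatticeModels Literature.Probability.Percolation Literature.Barriers.CriticalPhenomena in let μ : (L : ℕ) → MeasureTheory.Measure (BondConfig (BoxV 3 L)) := fun L => rcMeasure (boxGraph 3 L) (fkIsingParam (criticalBeta 3)) 2 (boxBoundary 3 L); let Conn : (L : ℕ) → Set (Site 3) → Set (Site 3) → Set (BondConfig (BoxV 3 L)) := fun L S T => {ω | ∃ a b : BoxV 3 L, a.1 ∈ S ∧ b.1 ∈ T ∧ (openGraph ω).Reachable a b}; let Bx : Site 3 → ℕ → Set (Site 3)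 := fun x m => {y | ∀ i, |y i - x i| ≤ m}; let FarEv : (L : ℕ) → Set (Site 3) → Set (BondConfig (BoxV 3 L)) → Prop := fun L Q F => ∀ ω ω' : BondConfig (BoxV 3 L), ω ⊆ (boxGraph 3 L).edgeSet → ω' ⊆ (boxGraph 3 L).edgeSet → (∀ u v : BoxV 3 L, u.1 ∉ Q → v.1 ∉ Q → (s(u, v) ∈ ω ↔ s(u, v) ∈ ω')) → (ω ∈ F ↔ ω' ∈ F); ∀ ε : ℝ, 0 < ε → ∃ lam m₀ : ℕ, ∀ m : ℕ, m₀ ≤ m → ∀ M : ℕ, lam * m ≤ M → ∀ (L : ℕ) (x : Site 3) (S T T' : Set (Site 3)), x ∈ S → S ⊆ Bx x m → Bx x (M + 1) ⊆ (box 3 L : Set (Site 3)) → Disjoint T (Bx x M) → Disjoint T' (Bx x M) → ∀ F F' : Set (BondConfig (BoxV 3 L)), FarEv L (Bx x M) F → FarEv L (Bx x M) F' → (μ L).real (F ∩ Conn L {x} T) * (μ L).real (F' ∩ Conn L S T') ≤ (1 + ε) * ((μ L).real (F' ∩ Conn L {x} T') * (μ L).real (F ∩ Conn L S T))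


end Registered

set_option linter.unusedVariables false in
/-- Internal target (a registered stub until revision 9, DERIVED in revision 10 by `stub_kestenArmMixingGlue` from
[K] and [Hyb]): Kesten's one-arm TV mixing with a buffer, [M']. -/
abbrev KestenArmMixing : Prop := open Literature.Probability.LatticeModels Literature.Probability.Percolation Literature.Barriers.CriticalPhenomena Filter Topology in let E3 := EuclideanSpace ℝ (Fin 3); let μ : (L : ℕ) → MeasureTheory.Measure (BondConfig (BoxV 3 L)) := fun L => rcMeasure (boxGraph 3 L) (fkIsingParam (criticalBeta 3)) 2 (boxBoundary 3 L); let PrL : (m : ℕ) → (Fin m → Set (Site 3)) → Set (Fin m → Fin m → Prop) → ℕ → ℝ := fun _ K R L => (μ L).real {ω | (fun i j => ∃ x y : BoxV 3 L, x.1 ∈ K i ∧ y.1 ∈ K j ∧ (openGraph ω).Reachable x y) ∈ R}; let Pr : (m : ℕ) → (Fin m → Set (Site 3)) → Set (Fin m → Fin m → Prop) → ℝ := fun m K R => limUnder atTop (PrL m K R); let mesh : ℝ → Site 3 → E3 := fun δ z => WithLp.toLp 2 fun i : Fin 3 => δ * (z i : ℝ); let disc : ℝ → Set E3 → Set (Site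 3) := fun δ A => {x | mesh δ x ∈ A}; let EVEN : (n : ℕ) → Set (Fin n → Fin n → Prop) := fun n => {R | ∀ i, Even ({j : Fin n | R i j}.ncard)}; let EVEN2 : (n : ℕ) → Set (Fin (n + n) → Fin (n + n) → Prop) := fun n => {R | ∀ i : Fin n, Even ({j : Fin n | R (Fin.castAdd n i) (Fin.castAdd n j)}.ncard)}; let CROSS : (n : ℕ) → Set (Fin (n + n) → Fin (n + n) → Prop) := fun n => {R | ∀ i : Fin n, R (Fin.castAdd n i) (Fin.natAdd n i)}; let pts : (n : ℕ) → ℝ → (Fin n → E3) → (Fin n → Set (Site 3)) := fun _ δ z j => {latticeApprox δ (z j)}; let fam : (n : ℕ) → ℝ → (Fin n → Set E3) → (Fin n → Set E3) → (Fin (n + n) → Set (Site 3)) := fun _ δ A B => Fin.append (fun j => disc δ (A j)) (fun j => disc δ (B j)); let Supp : (L : ℕ) → Set (BondConfig (BoxV 3 L)) := fun L => {ω | ω ⊆ (boxGraph 3 L).edgeSet}; let Ev : (m : ℕ) → (Fin m → Set (Site 3)) → Set (Fin m → Fin m → Prop) → (L : ℕ) → Set (BondConfig (BoxV 3 L)) :=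 fun _ K R L => {ω | (fun i j => ∃ x y : BoxV 3 L, x.1 ∈ K i ∧ y.1 ∈ K j ∧ (openGraph ω).Reachable x y) ∈ R}; let Out : (n : ℕ) → ℝ → (Fin n → E3) → (Fin n → ℝ) → (L : ℕ) → Set (BoxV 3 L) := fun _ δ b s L => {x | ∀ k, mesh δ x.1 ∉ Metric.closedBall (b k) (s k)}; let RO : (L : ℕ) → BondConfig (BoxV 3 L) → Set (BoxV 3 L) → BoxV 3 L → BoxV 3 L → Prop := fun L ω O x y => (SimpleGraph.fromRel fun a a' : BoxV 3 L => s(a, a') ∈ ω ∧ a ∈ O ∧ a' ∈ O).Reachable x y; let Crs : (n : ℕ) → ℝ → (Fin n → E3) → (Fin n → ℝ) → (Fin n → E3) → (Fin n → ℝ) → (L : ℕ) → BondConfig (BoxV 3 L) → Fin n → BoxV 3 L → Prop := fun n δ c r b s L ω j x => x ∈ Out n δ b s L ∧ (∃ y : BoxV 3 L, mesh δ y.1 ∈ Metric.closedBall (b j) (s j) ∧ (boxGraph 3 L).Adj x y) ∧ (∃ y : BoxV 3 L, y ∈ Out n δ b s L ∧ mesh δ y.1 ∈ (Metric.ball (c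 j) (r j))ᶜ ∧ RO L ω (Out n δ b s L) x y); let Uni : (n : ℕ) → ℝ → (Fin n → E3) → (Fin n → ℝ) → (Fin n → E3) → (Fin n → ℝ) → (L : ℕ) → Set (BondConfig (BoxV 3 L)) := fun n δ c r b s L => {ω | ∀ (j : Fin n) (x x' : BoxV 3 L), Crs n δ c r b s L ω j x → Crs n δ c r b s L ω j x' → RO L ω (Out n δ b s L) x x'}; let Patt : (n : ℕ) → ℝ → (Fin n → E3) → (Fin n → ℝ) → (Fin n → E3) → (Fin n → ℝ) → (L : ℕ) → Set (BondConfig (BoxV 3 L)) := fun n δ c r b s L => {ω | (fun i j => ∃ x x' : BoxV 3 L, Crs n δ c r b s L ω i x ∧ Crs n δ c r b s L ω j x' ∧ RO L ω (Out n δ b s L) x x') ∈ EVEN n}; ∀ (n : ℕ), 2 ≤ n → Even n → ∀ (c : Fin n → E3) (r : Fin n → ℝ), (∀ j, 0 < r j) → (∀ j k, j ≠ k → Disjoint (Metric.closedBall (c j) (r j)) (Metric.closedBall (c k) (r k))) → ∀ z₀ : Fin n → E3, (∀ j, z₀ j ∈ Metric.ball (c j) (r j)) → ∀ t : Fin n →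 ℝ, (∀ j, 0 < t j) → (∀ j, Metric.closedBall (z₀ j) (t j) ⊆ Metric.ball (c j) (r j)) → ∀ ε : ℝ, 0 < ε → ∃ V ∈ 𝓝 z₀, ∃ η₀ : ℝ, 0 < η₀ ∧ ∀ (b : Fin n → E3) (s : Fin n → ℝ), (∀ j, 0 < s j ∧ s j < η₀) → (∀ j, Metric.closedBall (b j) (s j) ⊆ Metric.ball (z₀ j) (t j / 2)) → ∀ᶠ δ in 𝓝[>] 0, ∀ z ∈ V, (∀ j, z j ∈ Metric.ball (b j) (s j / 2)) → ∀ E : (L : ℕ) → Set (BondConfig (BoxV 3 L)), (∀ (L : ℕ) (ω ω' : BondConfig (BoxV 3 L)), (∀ x y : BoxV 3 L, x ∈ Out n δ z₀ t L → y ∈ Out n δ z₀ t L → (s(x, y) ∈ ω ↔ s(x, y) ∈ ω')) → (ω ∈ E L ↔ ω' ∈ E L)) → ∀ᶠ L in atTop, |(μ L).real (E L ∩ Ev (n + n) (Fin.append (pts n δ z) (fun j => disc δ (Metric.ball (c j) (r j))ᶜ)) (CROSS n) L) / (μ L).real (Ev (n + n) (Fin.append (pts n δ z) (fun j => disc δ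 (Metric.ball (c j) (r j))ᶜ)) (CROSS n) L) - (μ L).real (E L ∩ Ev (n + n) (fam n δ (fun j => Metric.closedBall (b j) (s j)) (fun j => (Metric.ball (c j) (r j))ᶜ)) (CROSS n) L) / (μ L).real (Ev (n + n) (fam n δ (fun j => Metric.closedBall (b j) (s j)) (fun j => (Metric.ball (c j) (r j))ᶜ)) (CROSS n) L)| ≤ ε

set_option linter.unusedVariables false in
/-- Internal target (the registered stub U_b of revision 10, DERIVED in revision 11 by `ballCrossingUnique_of_annulus` from
[U1]): ball-conditioned uniqueness of the reading-scale crossing clusters. -/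
abbrev BallCrossingUnique : Prop := open Literature.Probability.LatticeModels Literature.Probability.Percolation Literature.Barriers.CriticalPhenomena Filter Topology in let E3 := EuclideanSpace ℝ (Fin 3); let μ : (L : ℕ) → MeasureTheory.Measure (BondConfig (BoxV 3 L)) := fun L => rcMeasure (boxGraph 3 L) (fkIsingParam (criticalBeta 3)) 2 (boxBoundary 3 L); let mesh : ℝ → Site 3 → E3 := fun δ z => WithLp.toLp 2 fun i : Fin 3 => δ * (z i : ℝ); let disc : ℝ → Set E3 → Set (Site 3) := fun δ A => {x | mesh δ x ∈ A}; let CROSS : (n : ℕ) → Set (Fin (n + n) → Fin (n + n) → Prop) := fun n => {R | ∀ i : Fin n, R (Fin.castAdd n i) (Fin.natAdd n i)}; let fam : (n : ℕ) → ℝ → (Fin n → Set E3) → (Fin n → Set E3) → (Fin (n + n) → Set (Site 3)) := fun _ δ A B => Fin.append (fun j => disc δ (A j)) (fun j => disc δ (B j)); let Ev : (m : ℕ) → (Fin m → Set (Site 3)) → Set (Fin m → Fin m → Prop) → (L : ℕ) → Set (BondConfig (BoxV 3 L)) := fun _ K R L => {ω | (fun i j => ∃ x y : BoxV 3 L, x.1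 ∈ K i ∧ y.1 ∈ K j ∧ (openGraph ω).Reachable x y) ∈ R}; let Out : (n : ℕ) → ℝ → (Fin n → E3) → (Fin n → ℝ) → (L : ℕ) → Set (BoxV 3 L) := fun _ δ b s L => {x | ∀ k, mesh δ x.1 ∉ Metric.closedBall (b k) (s k)}; let RO : (L : ℕ) → BondConfig (BoxV 3 L) → Set (BoxV 3 L) → BoxV 3 L → BoxV 3 L → Prop := fun L ω O x y => (SimpleGraph.fromRel fun a a' : BoxV 3 L => s(a, a') ∈ ω ∧ a ∈ O ∧ a' ∈ O).Reachable x y; let Crs : (n : ℕ) → ℝ → (Fin n → E3) → (Fin n → ℝ) → (Fin n → E3) → (Fin n → ℝ) → (L : ℕ) → BondConfig (BoxV 3 L) → Fin n → BoxV 3 L → Prop := fun n δ c r b s L ω j x => x ∈ Out n δ b s L ∧ (∃ y : BoxV 3 L, mesh δ y.1 ∈ Metric.closedBall (b j) (s j) ∧ (boxGraph 3 L).Adj x y) ∧ (∃ y : BoxV 3 L, y ∈ Out n δ b s L ∧ mesh δ y.1 ∈ (Metric.ball (c j) (r j))ᶜ ∧ RO L ω (Out n δ b s L) x y); let Uni :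 (n : ℕ) → ℝ → (Fin n → E3) → (Fin n → ℝ) → (Fin n → E3) → (Fin n → ℝ) → (L : ℕ) → Set (BondConfig (BoxV 3 L)) := fun n δ c r b s L => {ω | ∀ (j : Fin n) (x x' : BoxV 3 L), Crs n δ c r b s L ω j x → Crs n δ c r b s L ω j x' → RO L ω (Out n δ b s L) x x'}; ∀ (n : ℕ), 2 ≤ n → Even n → ∀ (c : Fin n → E3) (r : Fin n → ℝ), (∀ j, 0 < r j) → (∀ j k, j ≠ k → Disjoint (Metric.closedBall (c j) (r j)) (Metric.closedBall (c k) (r k))) → ∀ z₀ : Fin n → E3, (∀ j, z₀ j ∈ Metric.ball (c j) (r j)) → ∀ ε : ℝ, 0 < ε → ∃ t₀ : ℝ, 0 < t₀ ∧ ∀ t : Fin n → ℝ, (∀ j, 0 < t j ∧ t j < t₀) → (∀ j, Metric.closedBall (z₀ j) (t j) ⊆ Metric.ball (c j) (r j)) → ∃ η₀ : ℝ, 0 < η₀ ∧ ∀ (b : Fin n → E3) (s : Fin n → ℝ), (∀ j, 0 < s j) → (∀ j, Metric.closedBall (b j) (s j) ⊆ Metric.ball (z₀ j) η₀) → (∀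 j, Metric.closedBall (b j) (s j) ⊆ Metric.ball (z₀ j) (t j / 2)) → ∀ᶠ δ in 𝓝[>] 0, ∀ᶠ L in atTop, (μ L).real (Ev (n + n) (fam n δ (fun j => Metric.closedBall (b j) (s j)) (fun j => (Metric.ball (c j) (r j))ᶜ)) (CROSS n) L ∩ (Uni n δ c r z₀ t L)ᶜ) ≤ ε * (μ L).real (Ev (n + n) (fam n δ (fun j => Metric.closedBall (b j) (s j)) (fun j => (Metric.ball (c j) (r j))ᶜ)) (CROSS n) L)

/-! ### Proved layer, revision 11 (lead c2): [U1] (single annulus, lattice, far-uniform) ⇒ [U_b] -/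

section AnnulusToBalls
open Literature.Probability.LatticeModels Literature.Probability.Percolation Literature.Barriers.CriticalPhenomena
open Summit.CriticalPhenomena.Ising3DConformalLimit.Theorems.EvenPatternDecoupling

set_option linter.unusedVariables false in
set_option maxHeartbeats 2000000 in
/-- **[U_b] DERIVED from [U1] (revision 11).** Given the crux data, `ε` and the reading family `(z₀, t)` with
`t_j < t₀ := g/(4λ)` (`g` = the common slack of the reading centres in the outer balls, `λ, ρ₀` from [U1] at `ε/n`): for
`δ` small (`ρ₀ δ ≤ t_j`, `δ < κ/4`) and `L` large, at ball `k` take `p = δ⁻¹ z₀_k`, `ρ = t_k/δ` (so `EB(p,ρ)` IS the reading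
ball `B̄(z₀_k,t_k)^δ`), `R = λρ` (so the mesh image of `W = EB(p,R)` lies in `B(c_k,r_k)`), seed `B̄(b_k,s_k)^δ`, target
`(B(c_k,r_k)ᶜ)^δ` and far event `F` = the other balls' arm events (determined off `W` by first-exit walk surgery,
`armEvent_iff_of_agree`, and the uniform separation of the outer balls); non-uniqueness of the reading-scale crossing
clusters at ball `k` implies `LNU` there (graph monotonicity of the restricted open graphs), and the union bound over
`k` gives `μ(ball arms ∩ Uniᶜ) ≤ n · (ε/n) · μ(ball arms)`. -/
theorem ballCrossingUnique_of_annulus (hU : Registered.stub_annulusCrossingUnique) : open Literature.Probability.LatticeModels Literature.Probability.Percolation Literature.Barriers.CriticalPhenomena Filter Topology in let E3 := EuclideanSpace ℝ (Fin 3); let μ : (L : ℕ) → MeasureTheory.Measure (BondConfig (BoxV 3 L)) := fun L => rcMeasure (boxGraph 3 L) (fkIsingParam (criticalBeta 3)) 2 (boxBoundary 3 L); let mesh : ℝ → Site 3 → E3 := fun δ z => WithLp.toLp 2 fun i : Fin 3 => δ * (z i : ℝ); let disc : ℝ → Set E3 → Set (Site 3) := fun δ A => {x | mesh δ x ∈ A};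 let CROSS : (n : ℕ) → Set (Fin (n + n) → Fin (n + n) → Prop) := fun n => {R | ∀ i : Fin n, R (Fin.castAdd n i) (Fin.natAdd n i)}; let fam : (n : ℕ) → ℝ → (Fin n → Set E3) → (Fin n → Set E3) → (Fin (n + n) → Set (Site 3)) := fun _ δ A B => Fin.append (fun j => disc δ (A j)) (fun j => disc δ (B j)); let Ev : (m : ℕ) → (Fin m → Set (Site 3)) → Set (Fin m → Fin m → Prop) → (L : ℕ) → Set (BondConfig (BoxV 3 L)) := fun _ K R L => {ω | (fun i j => ∃ x y : BoxV 3 L, x.1 ∈ K i ∧ y.1 ∈ K j ∧ (openGraph ω).Reachable x y) ∈ R}; let Out : (n : ℕ) → ℝ → (Fin n → E3) → (Fin n → ℝ) → (L : ℕ) → Set (BoxV 3 L) := fun _ δ b s L => {x | ∀ k, mesh δ x.1 ∉ Metric.closedBall (b k) (s k)}; let RO : (L : ℕ) → BondConfig (BoxV 3 L) → Set (BoxV 3 L) → BoxV 3 L → BoxV 3 L → Prop := fun L ω O x y => (SimpleGraph.fromRel fun a a' : BoxV 3 L => s(a, a') ∈ ω ∧ a ∈ O ∧ a' ∈ O).Reachable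 x y; let Crs : (n : ℕ) → ℝ → (Fin n → E3) → (Fin n → ℝ) → (Fin n → E3) → (Fin n → ℝ) → (L : ℕ) → BondConfig (BoxV 3 L) → Fin n → BoxV 3 L → Prop := fun n δ c r b s L ω j x => x ∈ Out n δ b s L ∧ (∃ y : BoxV 3 L, mesh δ y.1 ∈ Metric.closedBall (b j) (s j) ∧ (boxGraph 3 L).Adj x y) ∧ (∃ y : BoxV 3 L, y ∈ Out n δ b s L ∧ mesh δ y.1 ∈ (Metric.ball (c j) (r j))ᶜ ∧ RO L ω (Out n δ b s L) x y); let Uni : (n : ℕ) → ℝ → (Fin n → E3) → (Fin n → ℝ) → (Fin n → E3) → (Fin n → ℝ) → (L : ℕ) → Set (BondConfig (BoxV 3 L)) := fun n δ c r b s L => {ω | ∀ (j : Fin n) (x x' : BoxV 3 L), Crs n δ c r b s L ω j x → Crs n δ c r b s L ω j x' → RO L ω (Out n δ b s L) x x'}; ∀ (n : ℕ), 2 ≤ n → Even n → ∀ (c : Fin n → E3) (r : Fin n → ℝ), (∀ j, 0 < r j) → (∀ j k, j ≠ k → Disjoint (Metric.closedBall (c j) (r j)) (Metric.closedBall (c k)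 (r k))) → ∀ z₀ : Fin n → E3, (∀ j, z₀ j ∈ Metric.ball (c j) (r j)) → ∀ ε : ℝ, 0 < ε → ∃ t₀ : ℝ, 0 < t₀ ∧ ∀ t : Fin n → ℝ, (∀ j, 0 < t j ∧ t j < t₀) → (∀ j, Metric.closedBall (z₀ j) (t j) ⊆ Metric.ball (c j) (r j)) → ∃ η₀ : ℝ, 0 < η₀ ∧ ∀ (b : Fin n → E3) (s : Fin n → ℝ), (∀ j, 0 < s j) → (∀ j, Metric.closedBall (b j) (s j) ⊆ Metric.ball (z₀ j) η₀) → (∀ j, Metric.closedBall (b j) (s j) ⊆ Metric.ball (z₀ j) (t j / 2)) → ∀ᶠ δ in 𝓝[>] 0, ∀ᶠ L in atTop, (μ L).real (Ev (n + n) (fam n δ (fun j => Metric.closedBall (b j) (s j)) (fun j => (Metric.ball (c j) (r j))ᶜ)) (CROSS n) L ∩ (Uni n δ c r z₀ t L)ᶜ) ≤ ε * (μ L).real (Ev (n + n) (fam n δ (fun j => Metric.closedBall (b j) (s j)) (fun j => (Metric.ball (c j) (r j))ᶜ)) (CROSS n) L) := by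
  intro E3 μ mesh disc CROSS fam Ev Out RO Crs Uni n hn hev c r hr hdisj z₀ hz₀ ε hε
  -- constants
  have hn0 : (0:ℝ) < n := by exact_mod_cast (lt_of_lt_of_le two_pos hn)
  obtain ⟨lam, ρ₀, hlam, hρ₀, HU⟩ := hU (ε / n) (by positivity)
  have hlam0 : 0 < lam := lt_of_lt_of_le one_pos hlam
  obtain ⟨g, hg, hgk⟩ := exists_pos_le_forall (fun k => r k - dist (z₀ k) (c k))
    (fun k => sub_pos.2 (mem_ball.1 (hz₀ k)))
  obtain ⟨κ, hκ, hgap⟩ := exists_gap_of_disjoint c r hdisj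
  refine ⟨g / (4 * lam), by positivity, fun t ht htadm => ⟨1, one_pos, fun b s hs _hη hbs => ?_⟩⟩
  have hlt : ∀ k, lam * t k < g / 4 := fun k => by
    have h := (ht k).2
    calc lam * t k < lam * (g / (4 * lam)) := mul_lt_mul_of_pos_left h hlam0
      _ = g / 4 := by field_simp
  -- eventualities in `δ`
  have hδpos : ∀ᶠ δ in 𝓝[>] (0:ℝ), 0 < δ := self_mem_nhdsWithin
  have hδκ : ∀ᶠ δ in 𝓝[>] (0:ℝ), δ < κ / 4 :=
    (eventually_lt_nhds (by positivity : (0:ℝ) < κ / 4)).filter_mono nhdsWithin_le_nhds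
  have hδt : ∀ᶠ δ in 𝓝[>] (0:ℝ), ∀ k, ρ₀ * δ ≤ t k := by
    refine eventually_all.2 fun k => ?_
    have h : ∀ᶠ δ in 𝓝 (0:ℝ), δ ≤ t k / ρ₀ := eventually_le_nhds (by have := (ht k).1; positivity)
    exact (h.filter_mono nhdsWithin_le_nhds).mono fun δ hδ => by
      rw [le_div_iff₀ hρ₀] at hδ; linarith
  filter_upwards [hδpos, hδκ, hδt] with δ hδ hδκ' hδt'
  -- the lattice data of ball `k`: centre `p_k = δ⁻¹ z₀_k`, radii `ρ_k = t_k/δ`, `R_k = lam ρ_k`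
  have hρk : ∀ k, ρ₀ ≤ t k / δ := fun k => by rw [le_div_iff₀ hδ]; exact hδt' k
  -- mesh images of the annulus ball `W_k` lie inside `B(c_k, r_k)`
  have hWin : ∀ (k : Fin n) (y : Site 3),
      dist (WithLp.toLp 2 fun i : Fin 3 => (y i : ℝ) : E3) (δ⁻¹ • z₀ k) ≤ lam * (t k / δ) →
        mesh δ y ∈ ball (c k) (r k) := by
    intro k y hy
    have h1 : dist (mesh δ y) (z₀ k) ≤ lam * t k := by
      rw [show lam * (t k / δ) = lam * t k / δ by ring] at hy
      exact (dist_mesh_le_iff hδ y (z₀ k) (lam * t k)).2 hy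
    have h2 := hlt k
    have h3 := hgk k
    rw [mem_ball]
    calc dist (mesh δ y) (c k) ≤ dist (mesh δ y) (z₀ k) + dist (z₀ k) (c k) := dist_triangle _ _ _
      _ < r k := by linarith
  -- eventually in `L`: the balls `EB p_k (R_k + 2)` lie in the box
  have hLbox : ∀ᶠ L : ℕ in atTop, ∀ k, {y : Site 3 | dist (WithLp.toLp 2 fun i : Fin 3 => (y i : ℝ) : E3)
      (δ⁻¹ • z₀ k) ≤ lam * (t k / δ) + 2} ⊆ (box 3 L : Set (Site 3)) :=
    eventually_all.2 fun k => eventually_euclLatticeBall_subset_box (δ⁻¹ • z₀ k) (lam * (t k / δ) + 2)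
  filter_upwards [hLbox] with L hLb
  have hp01 : fkIsingParam (criticalBeta 3) ∈ Set.Icc (0:ℝ) 1 := fkIsingParam_mem_Icc (criticalBeta_nonneg (d := 3))
  haveI : MeasureTheory.IsFiniteMeasure (μ L) := by
    haveI := isProbabilityMeasure_rcMeasure (boxGraph 3 L) hp01 two_pos (boxBoundary 3 L)
    show MeasureTheory.IsFiniteMeasure (rcMeasure (boxGraph 3 L) (fkIsingParam (criticalBeta 3)) 2 (boxBoundary 3 L))
    infer_instance
  -- the events at volume `L`
  -- ball arms of index `j`, and the "other arms" `F k`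
  let BA : Fin n → Set (BondConfig (BoxV 3 L)) := fun j =>
    {ω | ∃ a b' : BoxV 3 L, a.1 ∈ disc δ (closedBall (b j) (s j)) ∧ b'.1 ∈ disc δ (ball (c j) (r j))ᶜ ∧
      (openGraph ω).Reachable a b'}
  let F : Fin n → Set (BondConfig (BoxV 3 L)) := fun k => ⋂ j, (if j = k then univ else BA j)
  let Q : Fin n → Set (Site 3) := fun k =>
    {y | dist (WithLp.toLp 2 fun i : Fin 3 => (y i : ℝ) : E3) (δ⁻¹ • z₀ k) ≤ t k / δ}
  let W : Fin n → Set (Site 3) := fun k =>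
    {y | dist (WithLp.toLp 2 fun i : Fin 3 => (y i : ℝ) : E3) (δ⁻¹ • z₀ k) ≤ lam * (t k / δ)}
  let LN : Fin n → Set (BondConfig (BoxV 3 L)) := fun k =>
    {ω | ∃ u u' : BoxV 3 L, u.1 ∉ Q k ∧ u'.1 ∉ Q k ∧ (∃ v : BoxV 3 L, v.1 ∈ Q k ∧ (boxGraph 3 L).Adj u v) ∧
      (∃ v' : BoxV 3 L, v'.1 ∈ Q k ∧ (boxGraph 3 L).Adj u' v') ∧
      (∃ w : BoxV 3 L, w.1 ∉ W k ∧ (SimpleGraph.fromRel fun a a' : BoxV 3 L =>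
        s(a, a') ∈ ω ∧ a.1 ∈ (Q k)ᶜ ∧ a'.1 ∈ (Q k)ᶜ).Reachable u w) ∧
      (∃ w' : BoxV 3 L, w'.1 ∉ W k ∧ (SimpleGraph.fromRel fun a a' : BoxV 3 L =>
        s(a, a') ∈ ω ∧ a.1 ∈ (Q k)ᶜ ∧ a'.1 ∈ (Q k)ᶜ).Reachable u' w') ∧
      ¬ (SimpleGraph.fromRel fun a a' : BoxV 3 L =>
        s(a, a') ∈ ω ∧ a.1 ∈ (Q k)ᶜ ∩ W k ∧ a'.1 ∈ (Q k)ᶜ ∩ W k).Reachable u u'}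
  -- (a) the joint ball-arm event is the intersection of the `BA j`
  have hB : Ev (n + n) (fam n δ (fun j => closedBall (b j) (s j)) fun j => (ball (c j) (r j))ᶜ) (CROSS n) L =
      ⋂ j, BA j := by
    ext ω
    simp only [mem_iInter, mem_setOf_eq, Ev, CROSS, fam, Fin.append_left, Fin.append_right, BA]
  have hFB : ∀ k, F k ∩ BA k = ⋂ j, BA j := by
    intro k
    ext ω
    simp only [F, mem_inter_iff, mem_iInter]
    constructor
    · rintro ⟨h1, h2⟩ j
      by_cases hjk : j = k
      · subst hjk; exact h2
      · have := h1 j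
        simp only [if_neg hjk] at this
        exact this
    · intro h
      refine ⟨fun j => ?_, h k⟩
      by_cases hjk : j = k
      · simp only [if_pos hjk]; exact mem_univ _
      · simp only [if_neg hjk]; exact h j
  -- (b) membership translations between the crux's reading balls and the lattice balls `Q k`, `W k`
  have hQiff : ∀ (k : Fin n) (y : Site 3), y ∈ Q k ↔ mesh δ y ∈ closedBall (z₀ k) (t k) := fun k y => by
    rw [mem_closedBall]; exact (dist_mesh_le_iff hδ y (z₀ k) (t k)).symm
  have hOutQ : ∀ (k : Fin n) (a : BoxV 3 L), a ∈ Out n δ z₀ t L → a.1 ∈ (Q k)ᶜ := fun k a ha hQ =>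
    ha k ((hQiff k a.1).1 hQ)
  have hQW_Out : ∀ (k : Fin n) (a : BoxV 3 L), a.1 ∈ (Q k)ᶜ ∩ W k → a ∈ Out n δ z₀ t L := by
    intro k a ⟨haQ, haW⟩ j
    by_cases hjk : j = k
    · subst hjk; exact fun h => haQ ((hQiff j a.1).2 h)
    · intro hj
      have h1 : mesh δ a.1 ∈ closedBall (c k) (r k) := ball_subset_closedBall (hWin k a.1 haW)
      have h2 : mesh δ a.1 ∈ closedBall (c j) (r j) := ball_subset_closedBall (htadm j hj)
      exact (Set.disjoint_left.1 (hdisj j k hjk)) h2 h1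
  -- (c) the deterministic inclusion: non-uniqueness at ball `k` under the arms ⇒ `LN k`
  have hincl : (⋂ j, BA j) ∩ (Uni n δ c r z₀ t L)ᶜ ⊆ ⋃ k, (F k ∩ BA k ∩ LN k) := by
    rintro ω ⟨hωB, hωU⟩
    have hωU' : ¬ ∀ (j : Fin n) (x x' : BoxV 3 L), Crs n δ c r z₀ t L ω j x → Crs n δ c r z₀ t L ω j x' →
        RO L ω (Out n δ z₀ t L) x x' := hωU
    push Not at hωU'
    obtain ⟨k, x, x', hx, hx', hnot⟩ := hωU'
    refine mem_iUnion.2 ⟨k, ?_, ?_⟩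
    · rw [hFB k]; exact hωB
    obtain ⟨hxO, ⟨y, hy, hxy⟩, ⟨w, hwO, hwfar, hxw⟩⟩ := hx
    obtain ⟨hxO', ⟨y', hy', hxy'⟩, ⟨w', hwO', hwfar', hxw'⟩⟩ := hx'
    have hmono : (SimpleGraph.fromRel fun a a' : BoxV 3 L => s(a, a') ∈ ω ∧ a ∈ Out n δ z₀ t L ∧ a' ∈ Out n δ z₀ t L) ≤
        SimpleGraph.fromRel fun a a' : BoxV 3 L => s(a, a') ∈ ω ∧ a.1 ∈ (Q k)ᶜ ∧ a'.1 ∈ (Q k)ᶜ :=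
      fromRel_restrict_mono ω (fun a ha => hOutQ k a ha)
    have hmono' : (SimpleGraph.fromRel fun a a' : BoxV 3 L =>
        s(a, a') ∈ ω ∧ a.1 ∈ (Q k)ᶜ ∩ W k ∧ a'.1 ∈ (Q k)ᶜ ∩ W k) ≤
        SimpleGraph.fromRel fun a a' : BoxV 3 L => s(a, a') ∈ ω ∧ a ∈ Out n δ z₀ t L ∧ a' ∈ Out n δ z₀ t L :=
      fromRel_restrict_mono ω (fun a ha => hQW_Out k a ha)
    have hwW : ∀ w₀ : BoxV 3 L, mesh δ w₀.1 ∈ (ball (c k) (r k))ᶜ → w₀.1 ∉ W k := fun w₀ hw₀ hW => hw₀ (hWin k w₀.1 hW)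
    refine ⟨x, x', hOutQ k x hxO, hOutQ k x' hxO', ⟨y, (hQiff k y.1).2 hy, hxy⟩, ⟨y', (hQiff k y'.1).2 hy', hxy'⟩,
      ⟨w, hwW w hwfar, hxw.mono hmono⟩, ⟨w', hwW w' hwfar', hxw'.mono hmono⟩, fun h => hnot (h.mono hmono')⟩
  -- (d) far-measurability of the other balls' arms off `W k`
  have hsepQ : ∀ (j k : Fin n), j ≠ k → ∀ u v : BoxV 3 L, mesh δ u.1 ∈ ball (c j) (r j) →
      (boxGraph 3 L).Adj u v → v.1 ∉ W k := by
    intro j k hjk u v hu huv hvW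
    have hadj : (zdGraph 3).Adj u.1 v.1 := huv
    have h1 := dist_mesh_le_of_adj hδ.le hadj
    have h2 : mesh δ v.1 ∈ closedBall (c k) (r k) := ball_subset_closedBall (hWin k v.1 hvW)
    exact hgap j k hjk (mesh δ u.1) (mesh δ v.1) (ball_subset_closedBall hu) (by linarith) h2
  have hDQ : ∀ (j k : Fin n), j ≠ k →
      Disjoint {v : BoxV 3 L | mesh δ v.1 ∈ ball (c j) (r j)} {v : BoxV 3 L | v.1 ∈ W k} := by
    intro j k hjk
    refine Set.disjoint_left.2 fun v hvD hvW => ?_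
    exact (Set.disjoint_left.1 (hdisj j k hjk)) (ball_subset_closedBall hvD)
      (ball_subset_closedBall (hWin k v.1 hvW))
  have hfarBA : ∀ (k j : Fin n), j ≠ k → ∀ ω ω' : BondConfig (BoxV 3 L), ω ⊆ (boxGraph 3 L).edgeSet →
      ω' ⊆ (boxGraph 3 L).edgeSet → (∀ u v : BoxV 3 L, u.1 ∉ W k → v.1 ∉ W k → (s(u, v) ∈ ω ↔ s(u, v) ∈ ω')) →
      (ω ∈ BA j ↔ ω' ∈ BA j) := by
    intro k j hjk ω ω' hω hω' hag
    exact armEvent_iff_of_agree (boxGraph 3 L) {v : BoxV 3 L | mesh δ v.1 ∈ ball (c j) (r j)}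
      {v : BoxV 3 L | v.1 ∈ W k} {v : BoxV 3 L | v.1 ∈ disc δ (closedBall (b j) (s j))}
      (fun v hv => by
        have hv' : mesh δ v.1 ∈ closedBall (b j) (s j) := hv
        show mesh δ v.1 ∈ ball (c j) (r j)
        have h1 := mem_ball.1 (hbs j hv')
        exact htadm j (mem_closedBall.2 (by linarith [(ht j).1])))
      (hDQ j k hjk) (fun u v hu huv => hsepQ j k hjk u v hu huv) ω ω' hω hω' hag
  have hfarF : ∀ (k : Fin n) (ω ω' : BondConfig (BoxV 3 L)), ω ⊆ (boxGraph 3 L).edgeSet →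
      ω' ⊆ (boxGraph 3 L).edgeSet → (∀ u v : BoxV 3 L, u.1 ∉ W k → v.1 ∉ W k → (s(u, v) ∈ ω ↔ s(u, v) ∈ ω')) →
      (ω ∈ F k ↔ ω' ∈ F k) := by
    intro k ω ω' hω hω' hag
    simp only [F, mem_iInter]
    refine forall_congr' fun j => ?_
    by_cases hjk : j = k
    · simp only [if_pos hjk, mem_univ]
    · simp only [if_neg hjk]; exact hfarBA k j hjk ω ω' hω hω' hag
  -- (e) the hypotheses of [U1] at ball `k`
  have hSk : ∀ k, disc δ (closedBall (b k) (s k)) ⊆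
      {y : Site 3 | dist (WithLp.toLp 2 fun i : Fin 3 => (y i : ℝ) : E3) (δ⁻¹ • z₀ k) ≤ t k / δ / 2} := by
    intro k y hy
    have hy' : mesh δ y ∈ closedBall (b k) (s k) := hy
    have h1 := mem_ball.1 (hbs k hy')
    show dist (WithLp.toLp 2 fun i : Fin 3 => (y i : ℝ) : E3) (δ⁻¹ • z₀ k) ≤ t k / δ / 2
    rw [show t k / δ / 2 = (t k / 2) / δ by ring]
    exact dist_emb_le_of_dist_mesh_lt hδ y (z₀ k) (t k / 2) h1
  have hTk : ∀ k, Disjoint (disc δ (ball (c k) (r k))ᶜ) (W k) :=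
    fun k => Set.disjoint_left.2 fun y hy hyW => hy (hWin k y hyW)
  have hUk : ∀ k, (μ L).real (F k ∩ BA k ∩ LN k) ≤ ε / n * (μ L).real (F k ∩ BA k) := fun k =>
    HU (t k / δ) (lam * (t k / δ)) (hρk k) le_rfl L (δ⁻¹ • z₀ k) (disc δ (closedBall (b k) (s k)))
      (disc δ (ball (c k) (r k))ᶜ) (hSk k) (hLb k) (hTk k) (F k) (hfarF k)
  -- (f) union bound
  have hincl' : Ev (n + n) (fam n δ (fun j => closedBall (b j) (s j)) fun j => (ball (c j) (r j))ᶜ) (CROSS n) L ∩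
      (Uni n δ c r z₀ t L)ᶜ ⊆ ⋃ k, (F k ∩ BA k ∩ LN k) := fun ω hω =>
    hincl ⟨(Set.ext_iff.1 hB ω).1 hω.1, hω.2⟩
  calc (μ L).real (Ev (n + n) (fam n δ (fun j => closedBall (b j) (s j)) fun j => (ball (c j) (r j))ᶜ) (CROSS n) L ∩
        (Uni n δ c r z₀ t L)ᶜ)
      ≤ (μ L).real (⋃ k, (F k ∩ BA k ∩ LN k)) :=
        MeasureTheory.measureReal_mono hincl' (MeasureTheory.measure_ne_top _ _)
    _ ≤ ∑ k, (μ L).real (F k ∩ BA k ∩ LN k) := MeasureTheory.measureReal_iUnion_fintype_le _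
    _ ≤ ∑ k : Fin n, ε / n * (μ L).real (⋂ j, BA j) := Finset.sum_le_sum fun k _ => by
        calc (μ L).real (F k ∩ BA k ∩ LN k) ≤ ε / n * (μ L).real (F k ∩ BA k) := hUk k
          _ = ε / n * (μ L).real (⋂ j, BA j) := by rw [hFB k]
    _ = ε * (μ L).real (⋂ j, BA j) := by
        rw [Finset.sum_const, Finset.card_univ, Fintype.card_fin, nsmul_eq_mul]
        field_simp
    _ = ε * (μ L).real (Ev (n + n) (fam n δ (fun j => closedBall (b j) (s j)) fun j => (ball (c j) (r j))ᶜ)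
        (CROSS n) L) := by rw [← hB]

end AnnulusToBalls

set_option linter.unusedVariables false in
/-- Internal target (the registered stub U' of revisions 4–9, DERIVED in revision 10 by `readingCrossingUnique_of` from
[U_b], [UoB] and [M']): uniqueness of the reading-scale crossing clusters under BOTH arm conditionings. -/
abbrev ReadingCrossingUnique : Prop := open Literature.Probability.LatticeModels Literature.Probability.Percolation Literature.Barriers.CriticalPhenomena Filter Topology in let E3 := EuclideanSpace ℝ (Fin 3); let μ : (L : ℕ) → MeasureTheory.Measure (BondConfig (BoxV 3 L)) := fun L => rcMeasure (boxGraph 3 L) (fkIsingParam (criticalBeta 3)) 2 (boxBoundary 3 L); let PrL : (m : ℕ) → (Fin m → Set (Site 3)) → Set (Fin m → Fin m → Prop) → ℕ → ℝ := fun _ K R L => (μ L).real {ω | (fun i j => ∃ x y : BoxV 3 L, x.1 ∈ K i ∧ y.1 ∈ K j ∧ (openGraph ω).Reachable x y) ∈ R}; let Pr : (m : ℕ) → (Fin m → Set (Site 3)) → Set (Fin m → Fin m → Prop) → ℝ := fun m K R => limUnder atTop (PrL m K R); let mesh : ℝ → Site 3 → E3 := fun δ z => WithLp.toLp 2 fun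 i : Fin 3 => δ * (z i : ℝ); let disc : ℝ → Set E3 → Set (Site 3) := fun δ A => {x | mesh δ x ∈ A}; let EVEN : (n : ℕ) → Set (Fin n → Fin n → Prop) := fun n => {R | ∀ i, Even ({j : Fin n | R i j}.ncard)}; let EVEN2 : (n : ℕ) → Set (Fin (n + n) → Fin (n + n) → Prop) := fun n => {R | ∀ i : Fin n, Even ({j : Fin n | R (Fin.castAdd n i) (Fin.castAdd n j)}.ncard)}; let CROSS : (n : ℕ) → Set (Fin (n + n) → Fin (n + n) → Prop) := fun n => {R | ∀ i : Fin n, R (Fin.castAdd n i) (Fin.natAdd n i)}; let pts : (n : ℕ) → ℝ → (Fin n → E3) → (Fin n → Set (Site 3)) := fun _ δ z j => {latticeApprox δ (z j)}; let fam : (n : ℕ) → ℝ → (Fin n → Set E3) → (Fin n → Set E3) → (Fin (n + n) → Set (Site 3)) := fun _ δ A B => Fin.append (fun j => disc δ (A j)) (fun j => disc δ (B j)); let Supp : (L : ℕ) → Set (BondConfig (BoxV 3 L)) := fun L => {ω | ω ⊆ (boxGraph 3 L).edgeSet}; let Ev : (m : ℕ) → (Fin m → Set (Site 3)) → Set (Fin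 m → Fin m → Prop) → (L : ℕ) → Set (BondConfig (BoxV 3 L)) := fun _ K R L => {ω | (fun i j => ∃ x y : BoxV 3 L, x.1 ∈ K i ∧ y.1 ∈ K j ∧ (openGraph ω).Reachable x y) ∈ R}; let Out : (n : ℕ) → ℝ → (Fin n → E3) → (Fin n → ℝ) → (L : ℕ) → Set (BoxV 3 L) := fun _ δ b s L => {x | ∀ k, mesh δ x.1 ∉ Metric.closedBall (b k) (s k)}; let RO : (L : ℕ) → BondConfig (BoxV 3 L) → Set (BoxV 3 L) → BoxV 3 L → BoxV 3 L → Prop := fun L ω O x y => (SimpleGraph.fromRel fun a a' : BoxV 3 L => s(a, a') ∈ ω ∧ a ∈ O ∧ a' ∈ O).Reachable x y; let Crs : (n : ℕ) → ℝ → (Fin n → E3) → (Fin n → ℝ) → (Fin n → E3) → (Fin n → ℝ) → (L : ℕ) → BondConfig (BoxV 3 L) → Fin n → BoxV 3 L → Prop := fun n δ c r b s L ω j x => x ∈ Out n δ b s L ∧ (∃ y : BoxV 3 L, mesh δ y.1 ∈ Metric.closedBall (b j) (s j) ∧ (boxGraph 3 L).Adj x y) ∧ (∃ y : BoxV 3 L,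 y ∈ Out n δ b s L ∧ mesh δ y.1 ∈ (Metric.ball (c j) (r j))ᶜ ∧ RO L ω (Out n δ b s L) x y); let Uni : (n : ℕ) → ℝ → (Fin n → E3) → (Fin n → ℝ) → (Fin n → E3) → (Fin n → ℝ) → (L : ℕ) → Set (BondConfig (BoxV 3 L)) := fun n δ c r b s L => {ω | ∀ (j : Fin n) (x x' : BoxV 3 L), Crs n δ c r b s L ω j x → Crs n δ c r b s L ω j x' → RO L ω (Out n δ b s L) x x'}; let Patt : (n : ℕ) → ℝ → (Fin n → E3) → (Fin n → ℝ) → (Fin n → E3) → (Fin n → ℝ) → (L : ℕ) → Set (BondConfig (BoxV 3 L)) := fun n δ c r b s L => {ω | (fun i j => ∃ x x' : BoxV 3 L, Crs n δ c r b s L ω i x ∧ Crs n δ c r b s L ω j x' ∧ RO L ω (Out n δ b s L) x x') ∈ EVEN n}; ∀ (n : ℕ), 2 ≤ n → Even n → ∀ (c : Fin n → E3) (r : Fin n → ℝ), (∀ j, 0 < r j) → (∀ j k, j ≠ k → Disjoint (Metric.closedBall (c j) (r j)) (Metric.closedBall (c k) (r k))) → ∀ z₀ : Fin n → E3, (∀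 j, z₀ j ∈ Metric.ball (c j) (r j)) → ∀ ε : ℝ, 0 < ε → ∃ t₀ : ℝ, 0 < t₀ ∧ ∀ t : Fin n → ℝ, (∀ j, 0 < t j ∧ t j < t₀) → (∀ j, Metric.closedBall (z₀ j) (t j) ⊆ Metric.ball (c j) (r j)) → ∃ V ∈ 𝓝 z₀, ∃ η₀ : ℝ, 0 < η₀ ∧ ∀ (b : Fin n → E3) (s : Fin n → ℝ), (∀ j, 0 < s j ∧ s j < η₀) → (∀ j, Metric.closedBall (b j) (s j) ⊆ Metric.ball (z₀ j) (t j / 2)) → ∀ᶠ δ in 𝓝[>] 0, ∀ z ∈ V, (∀ j, z j ∈ Metric.ball (b j) (s j / 2)) → ∀ᶠ L in atTop, (μ L).real (Ev (n + n) (Fin.append (pts n δ z) (fun j => disc δ (Metric.ball (c j) (r j))ᶜ)) (CROSS n) L ∩ (Uni n δ c r z₀ t L)ᶜ) ≤ ε * (μ L).real (Ev (n + n) (Fin.append (pts n δ z) (fun j => disc δ (Metric.ball (c j) (r j))ᶜ)) (CROSS n) L) ∧ (μ L).real (Ev (n + n) (fam n δ (fun j => Metric.closedBall (b j) (s j)) (fun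 j => (Metric.ball (c j) (r j))ᶜ)) (CROSS n) L ∩ (Uni n δ c r z₀ t L)ᶜ) ≤ ε * (μ L).real (Ev (n + n) (fam n δ (fun j => Metric.closedBall (b j) (s j)) (fun j => (Metric.ball (c j) (r j))ᶜ)) (CROSS n) L)

/-- [M'] DERIVED (revision 10): the LANDED glue `stub_kestenArmMixingGlue` (p165048; hybrid argument over the balls via
the LANDED `stub_hybridRatioChain`, p164679) turns the canonical single-ball lattice statement [K] into Kesten's
`n`-ball TV mixing with a buffer. (The landed signature drops [M']'s unused `let`-binders: same proposition.) -/
theorem kestenArmMixing_of_ratioMixing (hK : Registered.stub_oneArmRatioMixing) : KestenArmMixing :=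
  Summit.CriticalPhenomena.Ising3DConformalLimit.Theorems.EvenPatternDecoupling.stub_kestenArmMixingGlue hK


/-- Internal target (not a stub any more, revision 9): ONE-ARM HYPERSCALING AT EVERY RATIO [HS], DERIVED below from
the two registered item-stubs `stub_oneArmHyperscaling` (= item 15591) and `stub_twoPointDoubling` (= item 6150) by
`armHyperscalingAllRatios_of_items`. -/
abbrev ArmHyperscalingAllRatios : Prop := open Literature.Probability.LatticeModels Literature.Barriers.CriticalPhenomena in ∀ lam : ℕ, 1 ≤ lam → ∃ κ : ℝ, 0 < κ ∧ ∃ N₀ : ℕ, ∀ N : ℕ, N₀ ≤ N → κ * (thetaWiredBox 3 (fkIsingParam (criticalBeta 3)) 2 N) ^ 2 ≤ criticalTwoPoint 3 (Pi.single 0 ((lam * N : ℕ) : ℤ))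

/-! ### [HS] from items 15591 ∧ 6150: `armHyperscalingAllRatios_of_items`, LANDED p167550 (Theorems…HyperscalingOfItems) -/

set_option linter.unusedVariables false in
/-- Internal target (not a stub): the RSW-type macroscopic crossing non-degeneracy [N] of revision 3, DERIVED
from [HS] by the registered implication stub `stub_macroCrossingOfHyperscaling`. -/
abbrev MacroCrossingNondegenerate : Prop := open Literature.Probability.LatticeModels Literature.Probability.Percolation Literature.Barriers.CriticalPhenomena Filter Topology in let E3 := EuclideanSpace ℝ (Fin 3); let μ : (L : ℕ) → MeasureTheory.Measure (BondConfig (BoxV 3 L)) := fun L => rcMeasure (boxGraph 3 L) (fkIsingParam (criticalBeta 3)) 2 (boxBoundary 3 L); let PrL : (m : ℕ) → (Fin m → Set (Site 3)) → Set (Fin m → Fin m → Prop) → ℕ → ℝ := fun _ K R L => (μ L).real {ω | (fun i j => ∃ x y : BoxV 3 L, x.1 ∈ K i ∧ y.1 ∈ K j ∧ (openGraph ω).Reachable x y) ∈ R}; let Pr : (m : ℕ) → (Fin m → Set (Site 3)) → Set (Fin m → Fin m → Prop) → ℝ := fun m K R => limUnder atTop (PrL m K R); let mesh : ℝ → Site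 3 → E3 := fun δ z => WithLp.toLp 2 fun i : Fin 3 => δ * (z i : ℝ); let disc : ℝ → Set E3 → Set (Site 3) := fun δ A => {x | mesh δ x ∈ A}; let EVEN : (n : ℕ) → Set (Fin n → Fin n → Prop) := fun n => {R | ∀ i, Even ({j : Fin n | R i j}.ncard)}; let EVEN2 : (n : ℕ) → Set (Fin (n + n) → Fin (n + n) → Prop) := fun n => {R | ∀ i : Fin n, Even ({j : Fin n | R (Fin.castAdd n i) (Fin.castAdd n j)}.ncard)}; let CROSS : (n : ℕ) → Set (Fin (n + n) → Fin (n + n) → Prop) := fun n => {R | ∀ i : Fin n, R (Fin.castAdd n i) (Fin.natAdd n i)}; let pts : (n : ℕ) → ℝ → (Fin n → E3) → (Fin n → Set (Site 3)) := fun _ δ z j => {latticeApprox δ (z j)}; let fam : (n : ℕ) → ℝ → (Fin n → Set E3) → (Fin n → Set E3) → (Fin (n + n) → Set (Site 3)) := fun _ δ A B => Fin.append (fun j => disc δ (A j)) (fun j => disc δ (B j)); ∀ (n : ℕ), 2 ≤ n → Even n → ∀ (c : Fin n → E3) (r : Fin n → ℝ), (∀ j, 0 < r j) → (∀ j k, j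 ≠ k → Disjoint (Metric.closedBall (c j) (r j)) (Metric.closedBall (c k) (r k))) → ∀ (b : Fin n → E3) (s : Fin n → ℝ), (∀ j, 0 < s j) → (∀ j, Metric.closedBall (b j) (s j) ⊆ Metric.ball (c j) (r j)) → ∃ m : ℝ, 0 < m ∧ ∀ᶠ δ in 𝓝[>] 0, m ≤ Pr (n + n) (fam n δ (fun j => Metric.closedBall (b j) (s j)) (fun j => (Metric.ball (c j) (r j))ᶜ)) (CROSS n)

/-! ### The birth heart as internal target (DERIVED below by `pointToBallDecoupling_of_pieces`; the other two
birth stubs are derived with their statements written out: `ballPatternLimit_of`, `evenPatternNondegenerate_of_gluing`) -/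

set_option linter.unusedVariables false in
/-- Birth stub 2, the heart (locally uniform point-to-ball decoupling) — no longer a stub. -/
abbrev PointToBallDecoupling : Prop := open Literature.Probability.LatticeModels Literature.Probability.Percolation Literature.Barriers.CriticalPhenomena Filter Topology in let E3 := EuclideanSpace ℝ (Fin 3); let μ : (L : ℕ) → MeasureTheory.Measure (BondConfig (BoxV 3 L)) := fun L => rcMeasure (boxGraph 3 L) (fkIsingParam (criticalBeta 3)) 2 (boxBoundary 3 L); let PrL : (m : ℕ) → (Fin m → Set (Site 3)) → Set (Fin m → Fin m → Prop) → ℕ → ℝ := fun _ K R L => (μ L).real {ω | (fun i j => ∃ x y : BoxV 3 L, x.1 ∈ K i ∧ y.1 ∈ K j ∧ (openGraph ω).Reachable x y) ∈ R}; let Pr : (m : ℕ) → (Fin m → Set (Site 3)) → Set (Fin m → Fin m → Prop) → ℝ := fun m K R => limUnder atTop (PrL m K R); let mesh : ℝ → Site 3 → E3 := fun δ z => WithLp.toLp 2 fun i : Fin 3 => δ * (z i : ℝ); let disc : ℝ → Set E3 → Set (Site 3) := fun δ A => {x | mesh δ x ∈ A}; let EVEN : (n : ℕ) → Set (Fin n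 → Fin n → Prop) := fun n => {R | ∀ i, Even ({j : Fin n | R i j}.ncard)}; let EVEN2 : (n : ℕ) → Set (Fin (n + n) → Fin (n + n) → Prop) := fun n => {R | ∀ i : Fin n, Even ({j : Fin n | R (Fin.castAdd n i) (Fin.castAdd n j)}.ncard)}; let CROSS : (n : ℕ) → Set (Fin (n + n) → Fin (n + n) → Prop) := fun n => {R | ∀ i : Fin n, R (Fin.castAdd n i) (Fin.natAdd n i)}; let pts : (n : ℕ) → ℝ → (Fin n → E3) → (Fin n → Set (Site 3)) := fun _ δ z j => {latticeApprox δ (z j)}; let fam : (n : ℕ) → ℝ → (Fin n → Set E3) → (Fin n → Set E3) → (Fin (n + n) → Set (Site 3)) := fun _ δ A B => Fin.append (fun j => disc δ (A j)) (fun j => disc δ (B j)); ∀ (n : ℕ), 2 ≤ n → Even n → ∀ (c : Fin n → E3) (r : Fin n → ℝ), (∀ j, 0 < r j) → (∀ j k, j ≠ k → Disjoint (Metric.closedBall (c j) (r j)) (Metric.closedBall (c k) (r k))) → ∀ z₀ : Fin n → E3, (∀ j, z₀ j ∈ Metric.ball (c j) (r j)) → ∀ ε : ℝ, 0 < ε →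 ∃ V ∈ 𝓝 z₀, ∃ η₀ : ℝ, 0 < η₀ ∧ ∀ (b : Fin n → E3) (s : Fin n → ℝ), (∀ j, 0 < s j ∧ s j < η₀) → (∀ j, Metric.closedBall (b j) (s j) ⊆ Metric.ball (c j) (r j)) → ∀ᶠ δ in 𝓝[>] 0, ∀ z ∈ V, (∀ j, z j ∈ Metric.ball (b j) (s j / 2)) → |Pr n (pts n δ z) (EVEN n) / Pr (n + n) (Fin.append (pts n δ z) (fun j => disc δ (Metric.ball (c j) (r j))ᶜ)) (CROSS n) - Pr (n + n) (fam n δ (fun j => Metric.closedBall (b j) (s j)) (fun j => (Metric.ball (c j) (r j))ᶜ)) (EVEN2 n ∩ CROSS n) / Pr (n + n) (fam n δ (fun j => Metric.closedBall (b j) (s j)) (fun j => (Metric.ball (c j) (r j))ᶜ)) (CROSS n)| ≤ ε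

/-! ### Birth assembly `admissible_of_fine`, `decoupling_assembly`: LANDED p167631 (Theorems…AssemblyBirth) -/

/-! ### Reshape layer (lead c1): LANDED p167761 (AssemblyReading), p168188 (RestrictedGraphs) -/

/-! `abs_div_sub_div_le`, `measureReal_transfer`, `pieces_assembly2`: LANDED p167761 (Theorems…AssemblyReading) -/

/-! `not_tendsto_zero_of_eventually_le`, `exists_tendsto_div_of_ballLaws`: LANDED p168000 (Theorems…BallLawsRatio) -/

/-! ### Glue: the five open stubs + the landed theorems ⇒ the three birth targets ⇒ the crux -/

set_option linter.unusedVariables false in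
/-- The dependency on crux A made formal: `BallConnectivityMoebius` (item 16131) gives stub A verbatim
(its second conjunct). A remark, not used by the assembly. -/
theorem ballLawsExist_of_ballConnectivityMoebius
    (hA : Summit.CriticalPhenomena.Ising3DConformalLimit.Theses.ArmDressing.BallConnectivityMoebius) :
    open Literature.Probability.LatticeModels Literature.Probability.Percolation Literature.Barriers.CriticalPhenomena Filter Topology in let E3 := EuclideanSpace ℝ (Fin 3); let μ : (L : ℕ) → MeasureTheory.Measure (BondConfig (BoxV 3 L)) := fun L => rcMeasure (boxGraph 3 L) (fkIsingParam (criticalBeta 3)) 2 (boxBoundary 3 L); let PrL : (m : ℕ) → (Fin m → Set (Site 3)) → Set (Fin m → Fin m → Prop) → ℕ → ℝ := fun _ K R L => (μ L).real {ω | (fun i j => ∃ x y : BoxV 3 L, x.1 ∈ K i ∧ y.1 ∈ K j ∧ (openGraph ω).Reachable x y) ∈ R}; let Pr : (m : ℕ) → (Fin m → Set (Site 3)) → Set (Fin m → Fin m → Prop) → ℝ := fun m K R => limUnder atTop (PrL m K R); let mesh : ℝ → Site 3 → E3 := fun δ z => WithLp.toLp 2 fun i : Fin 3 => δ * (z i :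 ℝ); let disc : ℝ → Set E3 → Set (Site 3) := fun δ A => {x | mesh δ x ∈ A}; let EVEN : (n : ℕ) → Set (Fin n → Fin n → Prop) := fun n => {R | ∀ i, Even ({j : Fin n | R i j}.ncard)}; let EVEN2 : (n : ℕ) → Set (Fin (n + n) → Fin (n + n) → Prop) := fun n => {R | ∀ i : Fin n, Even ({j : Fin n | R (Fin.castAdd n i) (Fin.castAdd n j)}.ncard)}; let CROSS : (n : ℕ) → Set (Fin (n + n) → Fin (n + n) → Prop) := fun n => {R | ∀ i : Fin n, R (Fin.castAdd n i) (Fin.natAdd n i)}; let pts : (n : ℕ) → ℝ → (Fin n → E3) → (Fin n → Set (Site 3)) := fun _ δ z j => {latticeApprox δ (z j)}; let fam : (n : ℕ) → ℝ → (Fin n → Set E3) → (Fin n → Set E3) → (Fin (n + n) → Set (Site 3)) := fun _ δ A B => Fin.append (fun j => disc δ (A j)) (fun j => disc δ (B j)); ∀ (m : ℕ) (R : Set (Fin m → Fin m → Prop)), ∃ lam : (Fin m → E3 × ℝ) → ℝ, ∀ p : Fin m → E3 × ℝ, (∀ i, (p i).2 ≠ 0) → Tendsto (fun δ => Pr m (fun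 i => disc δ (if 0 < (p i).2 then Metric.closedBall (p i).1 (p i).2 else (Metric.ball (p i).1 (-(p i).2))ᶜ)) R) (𝓝[>] 0) (𝓝 (lam p)) := by
  intro E3 μ PrL Pr mesh disc EVEN EVEN2 CROSS pts fam m R
  obtain ⟨lam, -, hlam, -⟩ := hA m R
  exact ⟨lam, hlam⟩

set_option linter.unusedVariables false in
/-- Birth stub 1 DERIVED: ball laws exist (stub A) + macroscopic crossings non-degenerate (stub N) ⇒ the
ball-conditioned even-pattern ratio converges for every admissible family (`exists_tendsto_div_of_ballLaws`). -/
theorem ballPatternLimit_of (hL : Registered.stub_ballLawsExist)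
    (hN : MacroCrossingNondegenerate) :
    open Literature.Probability.LatticeModels Literature.Probability.Percolation Literature.Barriers.CriticalPhenomena Filter Topology in let E3 := EuclideanSpace ℝ (Fin 3); let μ : (L : ℕ) → MeasureTheory.Measure (BondConfig (BoxV 3 L)) := fun L => rcMeasure (boxGraph 3 L) (fkIsingParam (criticalBeta 3)) 2 (boxBoundary 3 L); let PrL : (m : ℕ) → (Fin m → Set (Site 3)) → Set (Fin m → Fin m → Prop) → ℕ → ℝ := fun _ K R L => (μ L).real {ω | (fun i j => ∃ x y : BoxV 3 L, x.1 ∈ K i ∧ y.1 ∈ K j ∧ (openGraph ω).Reachable x y) ∈ R}; let Pr : (m : ℕ) → (Fin m → Set (Site 3)) → Set (Fin m → Fin m → Prop) → ℝ := fun m K R => limUnder atTop (PrL m K R); let mesh : ℝ → Site 3 → E3 := fun δ z => WithLp.toLp 2 fun i : Fin 3 => δ * (z i : ℝ); let disc : ℝ → Set E3 → Set (Site 3) := fun δ A => {x | mesh δ x ∈ A}; let EVEN : (n : ℕ) → Set (Fin n → Fin n → Prop) := fun n => {R | ∀ i, Even ({j : Fin n | R i j}.ncard)}; let EVEN2 :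 (n : ℕ) → Set (Fin (n + n) → Fin (n + n) → Prop) := fun n => {R | ∀ i : Fin n, Even ({j : Fin n | R (Fin.castAdd n i) (Fin.castAdd n j)}.ncard)}; let CROSS : (n : ℕ) → Set (Fin (n + n) → Fin (n + n) → Prop) := fun n => {R | ∀ i : Fin n, R (Fin.castAdd n i) (Fin.natAdd n i)}; let pts : (n : ℕ) → ℝ → (Fin n → E3) → (Fin n → Set (Site 3)) := fun _ δ z j => {latticeApprox δ (z j)}; let fam : (n : ℕ) → ℝ → (Fin n → Set E3) → (Fin n → Set E3) → (Fin (n + n) → Set (Site 3)) := fun _ δ A B => Fin.append (fun j => disc δ (A j)) (fun j => disc δ (B j)); ∀ (n : ℕ), 2 ≤ n → Even n → ∀ (c : Fin n → E3) (r : Fin n → ℝ), (∀ j, 0 < r j) → (∀ j k, j ≠ k → Disjoint (Metric.closedBall (c j) (r j)) (Metric.closedBall (c k) (r k))) → ∀ (b : Fin n → E3) (s : Fin n → ℝ), (∀ j, 0 < s j) → (∀ j, Metric.closedBall (b j) (s j) ⊆ Metric.ball (c j) (r j)) → ∃ M : ℝ, Tendsto (fun δ => Pr (n + n) (fam n δ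 (fun j => Metric.closedBall (b j) (s j)) (fun j => (Metric.ball (c j) (r j))ᶜ)) (EVEN2 n ∩ CROSS n) / Pr (n + n) (fam n δ (fun j => Metric.closedBall (b j) (s j)) (fun j => (Metric.ball (c j) (r j))ᶜ)) (CROSS n)) (𝓝[>] 0) (𝓝 M) := by
  intro E3 μ PrL Pr mesh disc EVEN EVEN2 CROSS pts fam n hn he c r hr hd b s hs hbs
  obtain ⟨m, hm, hev⟩ := hN n hn he c r hr hd b s hs hbs
  exact Summit.CriticalPhenomena.Ising3DConformalLimit.Theorems.EvenPatternDecoupling.exists_tendsto_div_of_ballLaws (Pr (n + n)) disc (fun R => hL (n + n) R)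
    b c s r hs hr (EVEN2 n ∩ CROSS n) (CROSS n) (Summit.CriticalPhenomena.Ising3DConformalLimit.Theorems.EvenPatternDecoupling.not_tendsto_zero_of_eventually_le hm hev)

set_option linter.unusedVariables false in
open Literature.Probability.LatticeModels Literature.Probability.Percolation
  Literature.Barriers.CriticalPhenomena in
/-- PROVED (far-measurability): `Uni ∩ Patt` read at a reading family depends only on the edges with both
ends outside the reading balls — two configurations that agree on those edges induce the same restricted open
graph `RO`, hence the same crossing sites, uniqueness event and parity pattern. -/
theorem uniPatt_far : open Literature.Probability.LatticeModels Literature.Probability.Percolation Literature.Barriers.CriticalPhenomena Filter Topology in let E3 := EuclideanSpace ℝ (Fin 3); let μ : (L : ℕ) → MeasureTheory.Measure (BondConfig (BoxV 3 L)) := fun L => rcMeasure (boxGraph 3 L) (fkIsingParam (criticalBeta 3)) 2 (boxBoundary 3 L); let PrL : (m : ℕ) → (Fin m → Set (Site 3)) → Set (Fin m → Fin m → Prop) → ℕ → ℝ := fun _ K R L => (μ L).real {ω | (fun i j => ∃ x y : BoxV 3 L, x.1 ∈ K i ∧ y.1 ∈ K j ∧ (openGraph ω).Reachable x y) ∈ R};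 let Pr : (m : ℕ) → (Fin m → Set (Site 3)) → Set (Fin m → Fin m → Prop) → ℝ := fun m K R => limUnder atTop (PrL m K R); let mesh : ℝ → Site 3 → E3 := fun δ z => WithLp.toLp 2 fun i : Fin 3 => δ * (z i : ℝ); let disc : ℝ → Set E3 → Set (Site 3) := fun δ A => {x | mesh δ x ∈ A}; let EVEN : (n : ℕ) → Set (Fin n → Fin n → Prop) := fun n => {R | ∀ i, Even ({j : Fin n | R i j}.ncard)}; let EVEN2 : (n : ℕ) → Set (Fin (n + n) → Fin (n + n) → Prop) := fun n => {R | ∀ i : Fin n, Even ({j : Fin n | R (Fin.castAdd n i) (Fin.castAdd n j)}.ncard)}; let CROSS : (n : ℕ) → Set (Fin (n + n) → Fin (n + n) → Prop) := fun n => {R | ∀ i : Fin n, R (Fin.castAdd n i) (Fin.natAdd n i)}; let pts : (n : ℕ) → ℝ → (Fin n → E3) → (Fin n → Set (Site 3)) := fun _ δ z j => {latticeApprox δ (z j)}; let fam : (n : ℕ) → ℝ → (Fin n → Set E3) → (Fin n → Set E3) → (Fin (n + n) → Set (Site 3)) := fun _ δ A B => Fin.append (fun j => disc δ (A j)) (fun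 j => disc δ (B j)); let Supp : (L : ℕ) → Set (BondConfig (BoxV 3 L)) := fun L => {ω | ω ⊆ (boxGraph 3 L).edgeSet}; let Ev : (m : ℕ) → (Fin m → Set (Site 3)) → Set (Fin m → Fin m → Prop) → (L : ℕ) → Set (BondConfig (BoxV 3 L)) := fun _ K R L => {ω | (fun i j => ∃ x y : BoxV 3 L, x.1 ∈ K i ∧ y.1 ∈ K j ∧ (openGraph ω).Reachable x y) ∈ R}; let Out : (n : ℕ) → ℝ → (Fin n → E3) → (Fin n → ℝ) → (L : ℕ) → Set (BoxV 3 L) := fun _ δ b s L => {x | ∀ k, mesh δ x.1 ∉ Metric.closedBall (b k) (s k)}; let RO : (L : ℕ) → BondConfig (BoxV 3 L) → Set (BoxV 3 L) → BoxV 3 L → BoxV 3 L → Prop := fun L ω O x y => (SimpleGraph.fromRel fun a a' : BoxV 3 L => s(a, a') ∈ ω ∧ a ∈ O ∧ a' ∈ O).Reachable x y; let Crs : (n : ℕ) → ℝ → (Fin n → E3) → (Fin n → ℝ) → (Fin n → E3) → (Fin n → ℝ) → (L : ℕ) → BondConfig (BoxV 3 L) → Fin n → BoxV 3 L → Prop :=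 fun n δ c r b s L ω j x => x ∈ Out n δ b s L ∧ (∃ y : BoxV 3 L, mesh δ y.1 ∈ Metric.closedBall (b j) (s j) ∧ (boxGraph 3 L).Adj x y) ∧ (∃ y : BoxV 3 L, y ∈ Out n δ b s L ∧ mesh δ y.1 ∈ (Metric.ball (c j) (r j))ᶜ ∧ RO L ω (Out n δ b s L) x y); let Uni : (n : ℕ) → ℝ → (Fin n → E3) → (Fin n → ℝ) → (Fin n → E3) → (Fin n → ℝ) → (L : ℕ) → Set (BondConfig (BoxV 3 L)) := fun n δ c r b s L => {ω | ∀ (j : Fin n) (x x' : BoxV 3 L), Crs n δ c r b s L ω j x → Crs n δ c r b s L ω j x' → RO L ω (Out n δ b s L) x x'}; let Patt : (n : ℕ) → ℝ → (Fin n → E3) → (Fin n → ℝ) → (Fin n → E3) → (Fin n → ℝ) → (L : ℕ) → Set (BondConfig (BoxV 3 L)) := fun n δ c r b s L => {ω | (fun i j => ∃ x x' : BoxV 3 L, Crs n δ c r b s L ω i x ∧ Crs n δ c r b s L ω j x' ∧ RO L ω (Out n δ b s L) x x') ∈ EVEN n}; ∀ (n : ℕ) (δ : ℝ) (c : Fin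 n → E3) (r : Fin n → ℝ) (b' : Fin n → E3) (t : Fin n → ℝ) (L : ℕ) (ω ω' : BondConfig (BoxV 3 L)), (∀ x y : BoxV 3 L, x ∈ Out n δ b' t L → y ∈ Out n δ b' t L → (s(x, y) ∈ ω ↔ s(x, y) ∈ ω')) → (ω ∈ Uni n δ c r b' t L ∩ Patt n δ c r b' t L ↔ ω' ∈ Uni n δ c r b' t L ∩ Patt n δ c r b' t L) := by
  intro E3 μ PrL Pr mesh disc EVEN EVEN2 CROSS pts fam Supp Ev Out RO Crs Uni Patt n δ c r b' t L ω ω' hag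
  have hG : (SimpleGraph.fromRel fun a a' : BoxV 3 L => s(a, a') ∈ ω ∧ a ∈ Out n δ b' t L ∧ a' ∈ Out n δ b' t L) =
      SimpleGraph.fromRel fun a a' : BoxV 3 L => s(a, a') ∈ ω' ∧ a ∈ Out n δ b' t L ∧ a' ∈ Out n δ b' t L :=
    Summit.CriticalPhenomena.Ising3DConformalLimit.Theorems.EvenPatternDecoupling.fromRel_congr_of_agree ω ω' (Out n δ b' t L) hag
  have hRO : RO L ω (Out n δ b' t L) = RO L ω' (Out n δ b' t L) := by
    show (fun x y => (SimpleGraph.fromRel fun a a' : BoxV 3 L =>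
        s(a, a') ∈ ω ∧ a ∈ Out n δ b' t L ∧ a' ∈ Out n δ b' t L).Reachable x y) =
      fun x y => (SimpleGraph.fromRel fun a a' : BoxV 3 L =>
        s(a, a') ∈ ω' ∧ a ∈ Out n δ b' t L ∧ a' ∈ Out n δ b' t L).Reachable x y
    rw [hG]
  have hCrs : Crs n δ c r b' t L ω = Crs n δ c r b' t L ω' := by
    show (fun j x => x ∈ Out n δ b' t L ∧
        (∃ y : BoxV 3 L, mesh δ y.1 ∈ Metric.closedBall (b' j) (t j) ∧ (boxGraph 3 L).Adj x y) ∧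
        (∃ y : BoxV 3 L, y ∈ Out n δ b' t L ∧ mesh δ y.1 ∈ (Metric.ball (c j) (r j))ᶜ ∧
          RO L ω (Out n δ b' t L) x y)) =
      fun j x => x ∈ Out n δ b' t L ∧
        (∃ y : BoxV 3 L, mesh δ y.1 ∈ Metric.closedBall (b' j) (t j) ∧ (boxGraph 3 L).Adj x y) ∧
        (∃ y : BoxV 3 L, y ∈ Out n δ b' t L ∧ mesh δ y.1 ∈ (Metric.ball (c j) (r j))ᶜ ∧
          RO L ω' (Out n δ b' t L) x y)
    rw [hRO]
  show (ω ∈ {ω₁ : BondConfig (BoxV 3 L) | ∀ (j : Fin n) (x x' : BoxV 3 L), Crs n δ c r b' t L ω₁ j x →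
        Crs n δ c r b' t L ω₁ j x' → RO L ω₁ (Out n δ b' t L) x x'} ∩
      {ω₁ | (fun i j => ∃ x x' : BoxV 3 L, Crs n δ c r b' t L ω₁ i x ∧ Crs n δ c r b' t L ω₁ j x' ∧
        RO L ω₁ (Out n δ b' t L) x x') ∈ EVEN n}) ↔
    (ω' ∈ {ω₁ : BondConfig (BoxV 3 L) | ∀ (j : Fin n) (x x' : BoxV 3 L), Crs n δ c r b' t L ω₁ j x →
        Crs n δ c r b' t L ω₁ j x' → RO L ω₁ (Out n δ b' t L) x x'} ∩
      {ω₁ | (fun i j => ∃ x x' : BoxV 3 L, Crs n δ c r b' t L ω₁ i x ∧ Crs n δ c r b' t L ω₁ j x' ∧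
        RO L ω₁ (Out n δ b' t L) x x') ∈ EVEN n})
  simp only [Set.mem_inter_iff, Set.mem_setOf_eq]
  rw [hCrs, hRO]

set_option linter.unusedVariables false in
open Literature.Probability.LatticeModels Literature.Probability.Percolation
  Literature.Barriers.CriticalPhenomena in
/-- PROVED (far-measurability, revision 10): `Uni` read at a reading family depends only on the edges with both ends
outside the reading balls (same mechanism as `uniPatt_far`). -/
theorem uni_far : open Literature.Probability.LatticeModels Literature.Probability.Percolation Literature.Barriers.CriticalPhenomena Filter Topology in let E3 := EuclideanSpace ℝ (Fin 3); let μ : (L : ℕ) → MeasureTheory.Measure (BondConfig (BoxV 3 L)) := fun L => rcMeasure (boxGraph 3 L) (fkIsingParam (criticalBeta 3)) 2 (boxBoundary 3 L); let PrL : (m : ℕ) → (Fin m → Set (Site 3)) → Set (Fin m → Fin m → Prop) → ℕ → ℝ := fun _ K R L => (μ L).real {ω | (fun i j => ∃ x y : BoxV 3 L, x.1 ∈ K i ∧ y.1 ∈ K j ∧ (openGraph ω).Reachable x y) ∈ R}; let Pr : (m : ℕ) → (Fin m → Set (Site 3)) → Set (Fin m → Fin m → Prop) → ℝ := fun m K R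 => limUnder atTop (PrL m K R); let mesh : ℝ → Site 3 → E3 := fun δ z => WithLp.toLp 2 fun i : Fin 3 => δ * (z i : ℝ); let disc : ℝ → Set E3 → Set (Site 3) := fun δ A => {x | mesh δ x ∈ A}; let EVEN : (n : ℕ) → Set (Fin n → Fin n → Prop) := fun n => {R | ∀ i, Even ({j : Fin n | R i j}.ncard)}; let EVEN2 : (n : ℕ) → Set (Fin (n + n) → Fin (n + n) → Prop) := fun n => {R | ∀ i : Fin n, Even ({j : Fin n | R (Fin.castAdd n i) (Fin.castAdd n j)}.ncard)}; let CROSS : (n : ℕ) → Set (Fin (n + n) → Fin (n + n) → Prop) := fun n => {R | ∀ i : Fin n, R (Fin.castAdd n i) (Fin.natAdd n i)}; let pts : (n : ℕ) → ℝ → (Fin n → E3) → (Fin n → Set (Site 3)) := fun _ δ z j => {latticeApprox δ (z j)}; let fam : (n : ℕ) → ℝ → (Fin n → Set E3) → (Fin n → Set E3) → (Fin (n + n) → Set (Site 3)) := fun _ δ A B => Fin.append (fun j => disc δ (A j)) (fun j => disc δ (B j)); let Supp : (L : ℕ) → Set (BondConfig (BoxV 3 L)) := fun L => {ω | ω ⊆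 (boxGraph 3 L).edgeSet}; let Ev : (m : ℕ) → (Fin m → Set (Site 3)) → Set (Fin m → Fin m → Prop) → (L : ℕ) → Set (BondConfig (BoxV 3 L)) := fun _ K R L => {ω | (fun i j => ∃ x y : BoxV 3 L, x.1 ∈ K i ∧ y.1 ∈ K j ∧ (openGraph ω).Reachable x y) ∈ R}; let Out : (n : ℕ) → ℝ → (Fin n → E3) → (Fin n → ℝ) → (L : ℕ) → Set (BoxV 3 L) := fun _ δ b s L => {x | ∀ k, mesh δ x.1 ∉ Metric.closedBall (b k) (s k)}; let RO : (L : ℕ) → BondConfig (BoxV 3 L) → Set (BoxV 3 L) → BoxV 3 L → BoxV 3 L → Prop := fun L ω O x y => (SimpleGraph.fromRel fun a a' : BoxV 3 L => s(a, a') ∈ ω ∧ a ∈ O ∧ a' ∈ O).Reachable x y; let Crs : (n : ℕ) → ℝ → (Fin n → E3) → (Fin n → ℝ) → (Fin n → E3) → (Fin n → ℝ) → (L : ℕ) → BondConfig (BoxV 3 L) → Fin n → BoxV 3 L → Prop := fun n δ c r b s L ω j x => x ∈ Out n δ b s L ∧ (∃ y : BoxV 3 L, mesh δ y.1 ∈ Metric.closedBall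 (b j) (s j) ∧ (boxGraph 3 L).Adj x y) ∧ (∃ y : BoxV 3 L, y ∈ Out n δ b s L ∧ mesh δ y.1 ∈ (Metric.ball (c j) (r j))ᶜ ∧ RO L ω (Out n δ b s L) x y); let Uni : (n : ℕ) → ℝ → (Fin n → E3) → (Fin n → ℝ) → (Fin n → E3) → (Fin n → ℝ) → (L : ℕ) → Set (BondConfig (BoxV 3 L)) := fun n δ c r b s L => {ω | ∀ (j : Fin n) (x x' : BoxV 3 L), Crs n δ c r b s L ω j x → Crs n δ c r b s L ω j x' → RO L ω (Out n δ b s L) x x'}; let Patt : (n : ℕ) → ℝ → (Fin n → E3) → (Fin n → ℝ) → (Fin n → E3) → (Fin n → ℝ) → (L : ℕ) → Set (BondConfig (BoxV 3 L)) := fun n δ c r b s L => {ω | (fun i j => ∃ x x' : BoxV 3 L, Crs n δ c r b s L ω i x ∧ Crs n δ c r b s L ω j x' ∧ RO L ω (Out n δ b s L) x x') ∈ EVEN n}; ∀ (n : ℕ) (δ : ℝ) (c : Fin n → E3) (r : Fin n → ℝ) (b' : Fin n → E3) (t : Fin n → ℝ) (L : ℕ) (ω ω' : BondConfig (BoxV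 3 L)), (∀ x y : BoxV 3 L, x ∈ Out n δ b' t L → y ∈ Out n δ b' t L → (s(x, y) ∈ ω ↔ s(x, y) ∈ ω')) → (ω ∈ Uni n δ c r b' t L ↔ ω' ∈ Uni n δ c r b' t L) := by
  intro E3 μ PrL Pr mesh disc EVEN EVEN2 CROSS pts fam Supp Ev Out RO Crs Uni Patt n δ c r b' t L ω ω' hag
  have hG : (SimpleGraph.fromRel fun a a' : BoxV 3 L => s(a, a') ∈ ω ∧ a ∈ Out n δ b' t L ∧ a' ∈ Out n δ b' t L) =
      SimpleGraph.fromRel fun a a' : BoxV 3 L => s(a, a') ∈ ω' ∧ a ∈ Out n δ b' t L ∧ a' ∈ Out n δ b' t L :=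
    Summit.CriticalPhenomena.Ising3DConformalLimit.Theorems.EvenPatternDecoupling.fromRel_congr_of_agree ω ω' (Out n δ b' t L) hag
  have hRO : RO L ω (Out n δ b' t L) = RO L ω' (Out n δ b' t L) := by
    show (fun x y => (SimpleGraph.fromRel fun a a' : BoxV 3 L =>
        s(a, a') ∈ ω ∧ a ∈ Out n δ b' t L ∧ a' ∈ Out n δ b' t L).Reachable x y) =
      fun x y => (SimpleGraph.fromRel fun a a' : BoxV 3 L =>
        s(a, a') ∈ ω' ∧ a ∈ Out n δ b' t L ∧ a' ∈ Out n δ b' t L).Reachable x y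
    rw [hG]
  have hCrs : Crs n δ c r b' t L ω = Crs n δ c r b' t L ω' := by
    show (fun j x => x ∈ Out n δ b' t L ∧
        (∃ y : BoxV 3 L, mesh δ y.1 ∈ Metric.closedBall (b' j) (t j) ∧ (boxGraph 3 L).Adj x y) ∧
        (∃ y : BoxV 3 L, y ∈ Out n δ b' t L ∧ mesh δ y.1 ∈ (Metric.ball (c j) (r j))ᶜ ∧
          RO L ω (Out n δ b' t L) x y)) =
      fun j x => x ∈ Out n δ b' t L ∧
        (∃ y : BoxV 3 L, mesh δ y.1 ∈ Metric.closedBall (b' j) (t j) ∧ (boxGraph 3 L).Adj x y) ∧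
        (∃ y : BoxV 3 L, y ∈ Out n δ b' t L ∧ mesh δ y.1 ∈ (Metric.ball (c j) (r j))ᶜ ∧
          RO L ω' (Out n δ b' t L) x y)
    rw [hRO]
  show (∀ (j : Fin n) (x x' : BoxV 3 L), Crs n δ c r b' t L ω j x → Crs n δ c r b' t L ω j x' →
      RO L ω (Out n δ b' t L) x x') ↔
    (∀ (j : Fin n) (x x' : BoxV 3 L), Crs n δ c r b' t L ω' j x → Crs n δ c r b' t L ω' j x' →
      RO L ω' (Out n δ b' t L) x x')
  rw [hCrs, hRO]

open Literature.Probability.LatticeModels Literature.Probability.Percolation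
  Literature.Barriers.CriticalPhenomena in
/-- The old stub U' DERIVED (revision 10): ball-conditioned uniqueness [U_b] + the LANDED abstract transfer [UoB]
(`stub_uniqueOfBallAndMixing`, p165729) + Kesten TV mixing [M'] (derived from [K]) ⇒ uniqueness of the reading-scale
crossing clusters under both conditionings (`Uniᶜ` is a far event by `uni_far`; finite wired FK-Ising box measures). -/
theorem readingCrossingUnique_of (hUb : BallCrossingUnique) (hM : KestenArmMixing) :
    ReadingCrossingUnique := by
  intro n hn he c r hr hd
  have hp : fkIsingParam (criticalBeta 3) ∈ Set.Icc (0:ℝ) 1 :=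
    fkIsingParam_mem_Icc (criticalBeta_nonneg (d := 3))
  exact Summit.CriticalPhenomena.Ising3DConformalLimit.Theorems.EvenPatternDecoupling.stub_uniqueOfBallAndMixing
    (fun L => rcMeasure (boxGraph 3 L) (fkIsingParam (criticalBeta 3)) 2 (boxBoundary 3 L))
    (fun L => by
      haveI := isProbabilityMeasure_rcMeasure (boxGraph 3 L) hp two_pos (boxBoundary 3 L)
      infer_instance)
    c r _ _ _
    (fun δ b' t L (E : Set (BondConfig (BoxV 3 L))) => ∀ ω ω' : BondConfig (BoxV 3 L),
      (∀ x y : BoxV 3 L,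
        x ∈ {x : BoxV 3 L | ∀ k, (WithLp.toLp 2 fun i : Fin 3 => δ * (x.1 i : ℝ) : EuclideanSpace ℝ (Fin 3)) ∉
          Metric.closedBall (b' k) (t k)} →
        y ∈ {x : BoxV 3 L | ∀ k, (WithLp.toLp 2 fun i : Fin 3 => δ * (x.1 i : ℝ) : EuclideanSpace ℝ (Fin 3)) ∉
          Metric.closedBall (b' k) (t k)} →
        (s(x, y) ∈ ω ↔ s(x, y) ∈ ω')) → (ω ∈ E ↔ ω' ∈ E))
    (fun δ b' t L ω ω' hag => not_congr (uni_far n δ c r b' t L ω ω' hag))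
    (hUb n hn he c r hr hd) (hM n hn he c r hr hd)

open Literature.Probability.LatticeModels Literature.Probability.Percolation
  Literature.Barriers.CriticalPhenomena in
/-- THE HEART, DERIVED (kernel-checked) from the READING-scale pieces: the LANDED point→reading deterministic
transfer (`stub_patternTransferDet`, p150394, at the reading family) + the LANDED ball→reading transfer (`stub_ballReadingTransferDet`, p155842)
+ uniqueness at the reading scale (stub U') + Kesten TV mixing (stub M') + the LANDED box limits
(`stub_armBoxLimits` p149935, `stub_patternBoxLimits` p151733) + the LANDED mixed-family box limit (`stub_readingPatternBoxLimit`, p156155)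
⇒ the birth skeleton's `stub_kestenDecoupling` statement, by `pieces_assembly2` at the wired critical FK-Ising
box measures (finite: `isProbabilityMeasure_rcMeasure`; carried by box-edge configurations:
`rcMeasure_real_compl_support`; far-measurability of `Uni ∩ Patt`: `uniPatt_far`). -/
theorem pointToBallDecoupling_of_pieces (hU : ReadingCrossingUnique)
    (hM : KestenArmMixing) : PointToBallDecoupling := by
  intro n hn he c r hr hd
  have hp : fkIsingParam (criticalBeta 3) ∈ Set.Icc (0:ℝ) 1 :=
    fkIsingParam_mem_Icc (criticalBeta_nonneg (d := 3))
  exact Summit.CriticalPhenomena.Ising3DConformalLimit.Theorems.EvenPatternDecoupling.pieces_assembly2 (fun L => rcMeasure (boxGraph 3 L) (fkIsingParam (criticalBeta 3)) 2 (boxBoundary 3 L))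
    (fun L => by
      haveI := isProbabilityMeasure_rcMeasure (boxGraph 3 L) hp two_pos (boxBoundary 3 L)
      infer_instance)
    (fun L => {ω | ω ⊆ (boxGraph 3 L).edgeSet})
    (fun L => Summit.CriticalPhenomena.Ising3DConformalLimit.Theorems.EvenPatternDecoupling.rcMeasure_real_compl_support (boxGraph 3 L) hp two_pos (boxBoundary 3 L))
    c r _ _ _ _ _ _
    (fun δ b' t L (E : Set (BondConfig (BoxV 3 L))) => ∀ ω ω' : BondConfig (BoxV 3 L),
      (∀ x y : BoxV 3 L,
        x ∈ {x : BoxV 3 L | ∀ k, (WithLp.toLp 2 fun i : Fin 3 => δ * (x.1 i : ℝ) : EuclideanSpace ℝ (Fin 3)) ∉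
          Metric.closedBall (b' k) (t k)} →
        y ∈ {x : BoxV 3 L | ∀ k, (WithLp.toLp 2 fun i : Fin 3 => δ * (x.1 i : ℝ) : EuclideanSpace ℝ (Fin 3)) ∉
          Metric.closedBall (b' k) (t k)} →
        (s(x, y) ∈ ω ↔ s(x, y) ∈ ω')) → (ω ∈ E ↔ ω' ∈ E))
    (fun δ b' t L => uniPatt_far n δ c r b' t L)
    (fun b' t ht hadm => by
      obtain ⟨δ₀, hδ₀, H⟩ :=
        Summit.CriticalPhenomena.Ising3DConformalLimit.Theorems.EvenPatternDecoupling.stub_patternTransferDet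
          n c r hr hd b' t ht hadm
      exact ⟨δ₀, hδ₀, fun δ hδ hlt z hz =>
        (H δ hδ hlt z hz).mono fun L hL ω hω => ⟨(hL ω hω).1, (hL ω hω).2.1⟩⟩)
    (Summit.CriticalPhenomena.Ising3DConformalLimit.Theorems.EvenPatternDecoupling.stub_ballReadingTransferDet
      n c r hr hd)
    (hU n hn he c r hr hd) (hM n hn he c r hr hd)
    (Summit.CriticalPhenomena.Ising3DConformalLimit.Theorems.EvenPatternDecoupling.stub_armBoxLimits n c r)
    (fun z δ hδ =>
      (Summit.CriticalPhenomena.Ising3DConformalLimit.Theorems.EvenPatternDecoupling.stub_patternBoxLimits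
        n c r z (fun _ => 1) z δ hδ).1)
    (fun b s δ hδ =>
      (Summit.CriticalPhenomena.Ising3DConformalLimit.Theorems.EvenPatternDecoupling.stub_patternBoxLimits
        n c r b s b δ hδ).2.1)
    (fun b' t z δ hδ =>
      (Summit.CriticalPhenomena.Ising3DConformalLimit.Theorems.EvenPatternDecoupling.stub_patternBoxLimits
        n c r b' t z δ hδ).2.2.1)
    (Summit.CriticalPhenomena.Ising3DConformalLimit.Theorems.EvenPatternDecoupling.stub_readingPatternBoxLimit n c r)

/-! ### Non-degeneracy of the even pattern from [HS]: `evenPatternNondegenerate_of_HS`, LANDED p167551 (Theorems…NondegenerateOfHS) -/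

/-- [N] from [HS] through the registered implication stub. -/
theorem macroCrossing_of_HS (hHS : ArmHyperscalingAllRatios) : MacroCrossingNondegenerate :=
  Summit.CriticalPhenomena.Ising3DConformalLimit.Theorems.EvenPatternDecoupling.stub_macroCrossingOfHyperscaling hHS

/-- ASSEMBLY (kernel-checked, no sorry outside the stubs): the registered stubs imply the crux, literally
the route decl `Summit.CriticalPhenomena.Ising3DConformalLimit.Theses.ArmDressing.EvenPatternDecoupling`. -/
theorem EvenPatternDecoupling_of (hL : Registered.stub_ballLawsExist)
    (hOA : Registered.stub_oneArmHyperscaling) (hTD : Registered.stub_twoPointDoubling)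
    (hU1 : Registered.stub_annulusCrossingUnique) (hK : Registered.stub_oneArmRatioMixing) :
    Summit.CriticalPhenomena.Ising3DConformalLimit.Theses.ArmDressing.EvenPatternDecoupling := by
  have hHS : ArmHyperscalingAllRatios := Summit.CriticalPhenomena.Ising3DConformalLimit.Theorems.EvenPatternDecoupling.armHyperscalingAllRatios_of_items hOA hTD
  have h1 := ballPatternLimit_of hL (macroCrossing_of_HS hHS)
  have hM : KestenArmMixing := kestenArmMixing_of_ratioMixing hK
  have hKD := pointToBallDecoupling_of_pieces (readingCrossingUnique_of (ballCrossingUnique_of_annulus hU1) hM) hM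
  have h7 := Summit.CriticalPhenomena.Ising3DConformalLimit.Theorems.EvenPatternDecoupling.evenPatternNondegenerate_of_HS hHS
  intro n hn he c r hr hd
  exact Summit.CriticalPhenomena.Ising3DConformalLimit.Theorems.EvenPatternDecoupling.decoupling_assembly c r _ _ (h1 n hn he c r hr hd) (hKD n hn he c r hr hd)
    (h7 n hn he c r hr hd)

/-- The same assembly with the registered stubs plugged in (sorries only inside `stub_*`). -/
theorem EvenPatternDecoupling_of_stubs :
    Summit.CriticalPhenomena.Ising3DConformalLimit.Theses.ArmDressing.EvenPatternDecoupling :=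
  EvenPatternDecoupling_of stub_ballLawsExist stub_oneArmHyperscaling stub_twoPointDoubling
    stub_annulusCrossingUnique stub_oneArmRatioMixing

end Summit.CriticalPhenomena.Ising3DConformalLimit.Cruxes.EvenPatternDecoupling.Birth
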